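import Literature.NumberTheory.LFunctions.VinogradovKorobovNumerics
import Literature.NumberTheory.LFunctions.VinogradovKorobovIntermediateInputs
import Literature.NumberTheory.LFunctions.ExplicitZeroFreeRegionLaplace
import Mathlib.NumberTheory.ArithmeticFunction.VonMangoldt
import Mathlib.Analysis.Complex.AbsMax
import Mathlib.Analysis.SpecialFunctions.Trigonometric.Cotangent
import Mathlib.MeasureTheory.Integral.IntegralEqImproper
import Mathlib.Analysis.SpecialFunctions.Integrals.Basic
import HarnessLib

/-!
# Ford's zero-detector method behind Lemma 4.7 of Mossinghoff–Trudgian–Yang: the objects, the kernel bounds, and the assembly (Ford 2002, §§6–7)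

Topic `Literature/NumberTheory/LFunctions`. Part of the decomposition of the explicit
Vinogradov–Korobov zero-free region (rh.S10 = Mossinghoff–Trudgian–Yang, *Res. Number Theory*
10 (2024) = arXiv:2212.06867, Theorem 1.1; architecture in `VinogradovKorobov.lean`). The named
fact `Literature.NumberTheory.LFunctions.zero_inequality_mossinghoff_trudgian_yang`
(`VinogradovKorobovInputs.lean`) is **Lemma 4.7** of the source — the "zero inequality" for the
polynomial `P₄₀` — whose printed proof is one sentence: "We follow the argument of [Ford 2002,
Lemma 7.1], using our Lemma 4.6 instead of [Ford, Lemma 4.3], using Lemma 4.5 in place of [Ford,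
Lemma 4.2], and using the trigonometric polynomial (3.6) instead of (Ford's `P₄`)". This file
formalises **that argument** — Ford's §6 ((6.1)–(6.8)) and §7 (proof of Lemma 7.1, (7.2)–(7.10))
with MTY's substitutions — and PROVES Lemma 4.7 from the analytic lemmas it combines
(`Literature.NumberTheory.LFunctions.zero_inequality_mossinghoff_trudgian_yang_of_ford`). Everything
declared here is either a definition or a proved theorem; no named fact is introduced (D-0026):
the analytic inputs enter the assembly as explicit hypotheses whose statements are spelled out
with the predicates defined here.

## Contents

* **Objects** (Ford §§4–6; MTY §4). The one-sided Laplace transform `fordLaplace f`, the smoothed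
  prime sum `fordK f s = Σ Λ(n) f(log n) n^{-s}` (a finite sum for compactly supported `f`,
  `fordK_eq_sum`), the zeros of `ζ` near `1 + it` (`fordNearZeros t r`, finite; `fordN t r =
  N(t, r)` with multiplicities `riemannZetaZeroOrder`), the junk-free predicate
  `FordFarZeroSumLE t r S` ("`Σ_{|1+it−ρ| ≥ r} m(ρ)|1+it−ρ|^{-2} ≤ S`", all finite partial sums),
  Ford's kernel `g` ((6.4)) and `w = g ∗ g` — the tree's `fordKernelG θ`, `fordKernelW θ` of
  `VinogradovKorobovIntermediateInputs.lean` (real Laplace transform `fordLaplaceW θ x` there; the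
  same functions are `fordG`, `fordW` of `ExplicitZeroFreeRegionKernel.lean`, `fordW_eq_fordKernelW`)
  — the Laplace transform `fordLaplaceWC θ z = W(z)` at complex `z` (`= fordLaplaceW θ x` at real
  `x`, `fordLaplaceWC_ofReal`), the closed form `fordLaplaceW0 θ = W₀` (Ford (7.3) = MTY (4.4),
  with the tree's `fordC₀…fordC₃`), the smoothing function `fordSmoothF θ λ u = λe^{λu}w(λu)`
  ((6.6)), and `fordV θ c = V_c` (§7).
* **Proved about the kernel**: `w = 0` off `[−2θ cot θ, 2θ cot θ]`, `w(0) = ∫ g² > 0` (so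
  `fordSmoothW0 θ > 0` for all `0 < θ < π/2`); `W(z) = ∫_0^{2θ cot θ} e^{−zu} w(u) du`, **`W` is
  entire** (`differentiable_fordLaplaceWC`) and **`Re W(z) ≥ 0` for `Re z ≥ 0`** (Ford (6.8),
  `re_fordLaplaceWC_nonneg`, from the tree's proof of Kadiri's (H₂), `mtyH1_laplace_re_nonneg'`);
  `f ≥ 0`, its support, `f(0) = λ w(0)`; **`F(z) = W(z/λ − 1)`** (Ford (6.7), by substitution);
  **`|W₀(z)| ≤ H(R)/|z|³`** for `Re z ≥ −1`, `|z| ≥ R ≥ 3 > tan θ` (Ford (7.4), MTY after (4.6),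
  `norm_fordLaplaceW0_le`); **`|F₀(z)| ≤ C₅(R) λ f(0)/|z|²`** for `Re z ≥ 0`, `|z| ≥ (R+1)λ`
  (Ford (7.5)–(7.6) = MTY (4.7), `norm_fordLaplace_fordSmoothF_sub_le`, from the closed form).
* **Ford's Lemma 4.4** `Re(cot z − 1/z) ≥ −4 Re z/π²` (`Re z ≥ 0`, `|z| ≤ π/2`), proved from the
  partial-fraction expansion of `cot` (Mathlib's `cot_series_rep'`) and a telescoping series
  (`re_cot_sub_inv_ge`); `cot x − 1/x ≥ −0.348x` on `(0, π/4]` (Ford §7) from Taylor brackets;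
  **every solution `θ` of (4.1) with `b₁/b₀ ≥ 1.746` has `θ < 1.249`, hence `tan θ < 3 ≤ R`**
  (`fordTheta_lt`, `tan_fordTheta_lt_three`; certified values of `sin, cos` at `1.249`, `1.32`).
* **Ford (7.6)** `Re V_c(z) ≥ −c₅ c² w(0)` on `Re z ≥ c`, `|z| ≤ π/2` (`0 < c ≤ π/(2R+2)`), proved
  from the kernel facts by Lemma 4.4, the closed form and the maximum principle for `e^{−V_c}`
  (`Complex.norm_le_of_forall_mem_frontier_norm_le`) — `re_fordV_ge`.
* **Ford (6.1)**: `Σ_j b_j Re K(1 + ijt) ≥ 0` for a non-negative trigonometric polynomial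
  (`fordK_trigPoly_nonneg`).
* **The assembly** `zero_inequality_mossinghoff_trudgian_yang_of_ford`: Lemma 4.7 follows from
  (H1) Ford's smoothed zero detector **Ford Lemma 4.6 = MTY Lemma 4.2 + Lemma 4.3** (conclusion
  shape `FordDetectorIneq`, hypotheses `IsFordSmoothing`), (H2) **MTY Lemma 4.4** (Ford Lemma 5.1
  for degree `K`), (H3) **MTY Lemma 4.6** (far-zero sum, `mtyFarZeroBound`), and (H4) the two
  kernel facts of Ford §§6–7 that are not yet theorems of the tree (`FordKernelFacts θ`: `w ∈ C¹`,
  and the closed form (7.2)–(7.3) of `W` at complex arguments); the other kernel inputs are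
  theorems — `w(0)` (MTY (4.3)), `W(0)`, `W(−1)` (Ford (6.5)), `W'(0)` (MTY (4.6)) and
  `W(0) − W(x) ≤ x|W'(0)|` in `VinogradovKorobovIntermediateInputs.lean`, `Re W ≥ 0` on `Re z ≥ 0`
  (Ford (6.8)) here from `ExplicitZeroFreeRegionLaplace.lean` (`re_fordLaplaceWC_nonneg`), `W`
  entire here (`differentiable_fordLaplaceWC`). The proof follows Ford §7
  line by line: (6.1)–(6.2), the zero-free rectangle gives `Re z_ρ ≥ c` for every zero near
  `1 + ijt`, (7.6) bounds those terms, the `N(jt, η)` terms cancel since `π²c₅/4 − c₄ = −1/R < 0`,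
  (7.8) at the zero `β + it` itself, (7.9)–(7.10), `206.7 + 1.8 + 1.8 b₀/b ≤ 209.1`, division by
  `b₀ f(0) = λ w(0)`.

## What is NOT here, and why (faithfulness / status notes)

1. The four hypotheses (H1)–(H4) are not proved in the tree. (H1) is Ford's Lemma 4.6, resting on
   the zero detector Lemma 2.2 (Weierstrass–Hadamard products for `ξ`), Lemma 3.4 and Lemma 4.5;
   (H3) is MTY Lemma 4.6, resting on the Hasanalizade–Shen–Wong bound (3.8) (a named fact of
   `VinogradovKorobovInputs.lean`), Ford's Lemma 4.1 and MTY Lemma 4.5; (H2) is an Euler-product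
   computation with the Fourier transform of `sech²`; (H4) is calculus (differentiating the closed
   form of `w` on `[0, 2θ cot θ]`, `fordKernelW_eq_explicit`, and integrating `e^{-zu}` against it).
   They are stated here only
   as binder types of the assembly theorem (no `def … : Prop`), so that the discharge
   `zero_inequality_mossinghoff_trudgian_yang_holds` is exactly: prove (H1)–(H4).
2. (H1) is stated with Ford's hypotheses `A > 1`, `B > 0`, `0 < η ≤ 1/2` (Ford Lemma 4.6) rather
   than MTY's "(3.1) for some `A, B > 0`" (Lemma 4.2 as printed also copies `η ≤ 3/2` from Ford's
   (4.5), but its conclusion uses Lemma 4.1 with `σ − η ≥ 1/2`); (H3) likewise with `A > 1`. The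
   far-zero sum is passed to (H1) as any admissible bound `S` (`FordFarZeroSumLE`), which for a
   series of non-negative terms is equivalent to the printed statement with the sum itself.
3. MTY Lemma 4.4 is used in the form `Σ_j b_j ∫ ≥ −2b₀ log ζ(1+η)` (sum of the `K` absolutely
   convergent integrals) rather than `∫ Σ_j`.
4. The target fact is Lemma 4.7 as vendored (for `P₄₀`, `A > 6.5`, `|W'(0)|`; see the notes in
   `VinogradovKorobovInputs.lean`); the assembly needs `A > 1` only, and produces `|W'(0)|` from
   `−W'(0) ≤ |W'(0)|`.

## References

* K. Ford, *Zero-free regions for the Riemann zeta function*, Number Theory for the Millennium II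
  (Urbana 2000), A K Peters 2002, 25–56 = arXiv:1910.08205 (v4): Lemma 4.4, Lemma 4.6, Lemma 5.1,
  §6 (6.1)–(6.8), §7 Lemma 7.1 and its proof, (7.2)–(7.10) (`Ford2002Millennium`).
* M. J. Mossinghoff, T. S. Trudgian, A. Yang, *Explicit zero-free regions for the Riemann
  zeta-function*, Res. Number Theory 10 (2024) = arXiv:2212.06867: §4, (4.1)–(4.7),
  Lemmas 4.2–4.7 (`MossinghoffTrudgianYangRNT2024`).
-/

noncomputable section

open Complex Real MeasureTheory Finset Set Filter
open scoped Topology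

namespace Literature.NumberTheory.LFunctions

/-! ## The one-sided Laplace transform and the smoothed prime sum `K_f(s)` -/

/-- The one-sided Laplace transform `F(z) = ∫_0^∞ e^{-zu} f(u) du` of a real function `f`
(Ford 2002, Lemma 4.5; Mossinghoff–Trudgian–Yang Lemma 4.2). [cite: Ford2002Millennium, Lemma 4.5] -/
def fordLaplace (f : ℝ → ℝ) (z : ℂ) : ℂ :=
  ∫ u in Set.Ioi (0 : ℝ), Complex.exp (-(z * u)) * (f u : ℂ)

/-- The smoothed prime sum `K(s) = K_f(s) = Σ_{n ≥ 1} Λ(n) f(log n) n^{-s}` (Ford 2002, Lemma 4.5;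
a finite sum when `f` has compact support). [cite: Ford2002Millennium, Lemma 4.5] -/
def fordK (f : ℝ → ℝ) (s : ℂ) : ℂ :=
  ∑' n : ℕ, ((ArithmeticFunction.vonMangoldt n : ℝ) : ℂ) * (f (Real.log n) : ℂ) * (n : ℂ) ^ (-s)

/-- If `f` vanishes on `[x₀, ∞)` and `x₀ ≤ log N` (`N ≥ 1`), then `K_f(s)` is the finite sum over
`n < N`. [folklore] -/
theorem fordK_eq_sum {f : ℝ → ℝ} {x₀ : ℝ} (hf : ∀ u, x₀ ≤ u → f u = 0) {N : ℕ} (hN : 1 ≤ N)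
    (hx : x₀ ≤ Real.log N) (s : ℂ) :
    fordK f s = ∑ n ∈ Finset.range N,
      ((ArithmeticFunction.vonMangoldt n : ℝ) : ℂ) * (f (Real.log n) : ℂ) * (n : ℂ) ^ (-s) := by
  unfold fordK
  refine tsum_eq_sum fun n hn ↦ ?_
  rw [Finset.mem_range, not_lt] at hn
  have hlog : x₀ ≤ Real.log n := by
    refine hx.trans (Real.log_le_log (by exact_mod_cast hN) (by exact_mod_cast hn))
  simp [hf _ hlog]

/-! ## Zeros of `ζ` near `1 + it`, and the far-zero sums -/

/-- The zeros of `ζ` in the closed disc `|1 + it − ρ| ≤ r` (the range of the sums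
`Σ_{|1+it−ρ| ≤ r}` of Ford 2002, §4). [cite: Ford2002Millennium, §4 (N(t, R))] -/
def fordNearZeroSet (t r : ℝ) : Set ℂ :=
  {ρ | riemannZeta ρ = 0 ∧ ‖1 + t * I - ρ‖ ≤ r}

/-- The disc `|1 + it − ρ| ≤ r` contains finitely many zeros of `ζ` (zeros of `ζ` are discrete:
`IsCompact.inter_riemannZetaZeros_finite`). [folklore] -/
theorem fordNearZeroSet_finite (t r : ℝ) : (fordNearZeroSet t r).Finite := by
  refine ((isCompact_closedBall (1 + t * I : ℂ) r).inter_riemannZetaZeros_finite).subset ?_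
  rintro ρ ⟨h0, h1⟩
  refine ⟨Metric.mem_closedBall.2 ?_, h0⟩
  rwa [dist_comm, dist_eq_norm]

/-- The zeros of `ζ` with `|1 + it − ρ| ≤ r`, as a `Finset`. [cite: Ford2002Millennium, §4] -/
def fordNearZeros (t r : ℝ) : Finset ℂ :=
  (fordNearZeroSet_finite t r).toFinset

/-- Membership in `fordNearZeros`. [folklore] -/
theorem mem_fordNearZeros {t r : ℝ} {ρ : ℂ} :
    ρ ∈ fordNearZeros t r ↔ riemannZeta ρ = 0 ∧ ‖1 + t * I - ρ‖ ≤ r := by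
  simp [fordNearZeros, fordNearZeroSet]

/-- `N(t, r)`: the number of zeros `ρ` of `ζ` with `|1 + it − ρ| ≤ r`, counted with multiplicity
(`Literature.NumberTheory.LFunctions.riemannZetaZeroOrder`), read in `ℝ` (Ford 2002, §4;
Mossinghoff–Trudgian–Yang Lemma 4.5). [cite: Ford2002Millennium, §4 (N(t, R))] -/
def fordN (t r : ℝ) : ℝ :=
  ∑ ρ ∈ fordNearZeros t r, (riemannZetaZeroOrder ρ : ℝ)

/-- "`Σ_{|1+it−ρ| ≥ r} 1/|1 + it − ρ|² ≤ S`", the sum over the non-trivial zeros (`0 < Re ρ < 1`)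
with multiplicity, stated junk-free as: every finite partial sum is `≤ S` (for a series of
non-negative terms this is the printed assertion, and it implies convergence).
[cite: Ford2002Millennium, Lemma 4.3] -/
def FordFarZeroSumLE (t r S : ℝ) : Prop :=
  ∀ T : Finset ℂ, (∀ ρ ∈ T, riemannZeta ρ = 0 ∧ 0 < ρ.re ∧ ρ.re < 1 ∧ r ≤ ‖1 + t * I - ρ‖) →
    ∑ ρ ∈ T, (riemannZetaZeroOrder ρ : ℝ) / ‖1 + t * I - ρ‖ ^ 2 ≤ S

/-- `FordFarZeroSumLE` is monotone in the bound. [folklore] -/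
theorem FordFarZeroSumLE.mono {t r S S' : ℝ} (h : FordFarZeroSumLE t r S) (hS : S ≤ S') :
    FordFarZeroSumLE t r S' :=
  fun T hT ↦ (h T hT).trans hS

/-- `N(t, r) ≥ 0` (multiplicities of zeros are positive). [folklore] -/
theorem fordN_nonneg (t r : ℝ) : 0 ≤ fordN t r := by
  refine Finset.sum_nonneg fun ρ hρ ↦ ?_
  rw [mem_fordNearZeros] at hρ
  exact_mod_cast riemannZetaZeroOrder_nonneg fun h1 ↦ riemannZeta_one_ne_zero (h1 ▸ hρ.1)

/-! ## Ford's smoothing kernel (Ford 2002, §6, (6.3)–(6.7); Mossinghoff–Trudgian–Yang §4) -/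

/- Ford's `g` ((6.4); MTY §4) and `w = g ∗ g` are the tree's `fordKernelG θ`, `fordKernelW θ`
(`VinogradovKorobovIntermediateInputs.lean`, where `w(0) = fordSmoothW0 θ` (MTY (4.3)), the real
values `W(0)`, `W(−1)` (Ford (6.5)), `∫ u w = −W'(0)` ((4.6)) and `W(0) − W(X) ≤ X|W'(0)|` are
PROVED for the real Laplace transform `fordLaplaceW θ x`); the same `g`, `w` appear as `fordG`,
`fordW` in `ExplicitZeroFreeRegionKernel.lean` / `ExplicitZeroFreeRegionLaplace.lean`, where the
closed form `w = h^{(1)}_{1,θ}` on `[0, 2θ cot θ]` and the positivity of `Re` of its Laplace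
transform (Kadiri's (H₂) = Ford (6.8)) are proved. -/

/-- `W(z) = ∫_0^∞ e^{-zu} w(u) du` at COMPLEX arguments `z` — the Laplace transform of `w` (Ford §6;
its restriction to real `x` is the tree's `fordLaplaceW θ x`, `fordLaplaceWC_ofReal`).
[cite: Ford2002Millennium, §6 (definition of W)] -/
def fordLaplaceWC (θ : ℝ) (z : ℂ) : ℂ :=
  fordLaplace (fordKernelW θ) z

/-- `W₀(z) = c₀ (c₂[(z+1)² e^{−2θ cot θ · z} + z² − 1] − c₁ z − c₃ z³) / (z² (z² + tan²θ)²)`, the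
closed form of `W(z) − w(0)/z` (Ford (7.3); MTY (4.4)), with `c₀, …, c₃` the tree's
`fordC₀, …, fordC₃` (MTY (4.5)). [cite: MossinghoffTrudgianYangRNT2024, (4.4)–(4.5)] -/
def fordLaplaceW0 (θ : ℝ) (z : ℂ) : ℂ :=
  (fordC₀ θ : ℂ) *
      ((fordC₂ θ : ℂ) * ((z + 1) ^ 2 * Complex.exp (-(((2 * θ * Real.cot θ : ℝ) : ℂ) * z)) + z ^ 2 - 1)
        - (fordC₁ θ : ℂ) * z - (fordC₃ θ : ℂ) * z ^ 3) /
    (z ^ 2 * (z ^ 2 + (Real.tan θ : ℂ) ^ 2) ^ 2)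

/-- The smoothing function `f(u) = λ e^{λu} w(λu)` (Ford (6.6); MTY §4, "(f_defn)").
[cite: Ford2002Millennium, (6.6)] -/
def fordSmoothF (θ lam u : ℝ) : ℝ :=
  lam * Real.exp (lam * u) * fordKernelW θ (lam * u)

section kernel

variable {θ : ℝ} (hθ : 0 < θ) (hθ' : θ < π / 2)
include hθ hθ'

/-- `cot θ · tan θ = 1` on `(0, π/2)`. [folklore] -/
theorem cot_mul_tan : Real.cot θ * Real.tan θ = 1 := by
  rw [Real.cot_eq_cos_div_sin, Real.tan_eq_sin_div_cos]
  field_simp [(ford_sin_pos hθ hθ').ne', (ford_cos_pos hθ hθ').ne']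

/-- `g(u) = 0` for `|u| ≥ θ cot θ` (outside the support, and at its two endpoints, where
`cos(u tan θ) = cos θ`). [folklore] -/
theorem fordKernelG_eq_zero_of_le_abs {u : ℝ} (hu : θ * Real.cot θ ≤ |u|) : fordKernelG θ u = 0 := by
  unfold fordKernelG
  split_ifs with h
  · have heq : |u| = θ * Real.cot θ := le_antisymm h hu
    have : Real.cos (u * Real.tan θ) = Real.cos θ := by
      rw [← Real.cos_abs (u * Real.tan θ), abs_mul, abs_of_pos (ford_tan_pos hθ hθ'), heq,
        mul_assoc, cot_mul_tan hθ hθ', mul_one]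
    simp [this]
  · rfl

/-- For each `u`, `v ↦ g(v) g(u − v)` is integrable. [folklore] -/
theorem integrable_fordKernelG_mul (u : ℝ) :
    Integrable (fun v ↦ fordKernelG θ v * fordKernelG θ (u - v)) := by
  refine Integrable.mul_of_top_left (integrable_fordKernelG hθ hθ') ?_
  refine memLp_top_of_bound ((continuous_fordKernelG hθ hθ').comp (continuous_const.sub continuous_id)).aestronglyMeasurable
    (1 / Real.cos θ ^ 2) (Filter.Eventually.of_forall fun _ ↦ ?_)
  simp only [Real.norm_eq_abs]
  rw [abs_of_nonneg (fordKernelG_nonneg hθ hθ' _)]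
  exact fordKernelG_le hθ hθ' _

/-- `w(u) = 0` for `|u| ≥ 2θ cot θ`: the support of `w = g ∗ g` is `[−2θ cot θ, 2θ cot θ]`
(MTY §9: `d₁(θ) = 2θ cot θ`). [cite: MossinghoffTrudgianYangRNT2024, §9 (d₁(θ) = 2θ cot θ)] -/
theorem fordKernelW_eq_zero_of_le_abs {u : ℝ} (hu : 2 * (θ * Real.cot θ) ≤ |u|) : fordKernelW θ u = 0 := by
  rw [fordKernelW_apply]
  have : (fun v ↦ fordKernelG θ v * fordKernelG θ (u - v)) = fun _ ↦ 0 := by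
    funext v
    by_cases hv : θ * Real.cot θ ≤ |v|
    · rw [fordKernelG_eq_zero_of_le_abs hθ hθ' hv, zero_mul]
    · have : θ * Real.cot θ ≤ |u - v| := by
        have h1 := abs_sub_abs_le_abs_sub u v
        have h2 := not_le.1 hv
        linarith
      rw [fordKernelG_eq_zero_of_le_abs hθ hθ' this, mul_zero]
  rw [this, integral_zero]

/-- `w(0) = ∫ g² > 0`. [folklore] -/
theorem fordKernelW_zero_pos : 0 < fordKernelW θ 0 := by
  rw [fordKernelW_apply]
  simp only [zero_sub, fordKernelG_neg]
  have hcont : Continuous fun v ↦ fordKernelG θ v * fordKernelG θ v :=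
    (continuous_fordKernelG hθ hθ').mul (continuous_fordKernelG hθ hθ')
  have hint : Integrable fun v ↦ fordKernelG θ v * fordKernelG θ v := by
    simpa [fordKernelG_neg] using integrable_fordKernelG_mul hθ hθ' 0
  rw [integral_pos_iff_support_of_nonneg (fun _ ↦ mul_self_nonneg _) hint]
  have h0 : 0 < fordKernelG θ 0 * fordKernelG θ 0 := by
    have : 0 < fordKernelG θ 0 := by
      unfold fordKernelG
      rw [if_pos (by simpa using (ford_cot_pos hθ hθ').le)]
      refine div_pos (sub_pos.2 ?_) (pow_pos (ford_cos_pos hθ hθ') 2)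
      rw [zero_mul, Real.cos_zero]
      have := Real.cos_lt_cos_of_nonneg_of_le_pi le_rfl (by linarith [Real.pi_pos]) hθ
      rwa [Real.cos_zero] at this
    positivity
  have hopen : IsOpen (Function.support fun v ↦ fordKernelG θ v * fordKernelG θ v) :=
    hcont.isOpen_support
  exact hopen.measure_pos volume ⟨0, by simpa [Function.mem_support] using h0.ne'⟩

/-- The smoothing function is non-negative (`λ > 0`). [cite: Ford2002Millennium, §6] -/
theorem fordSmoothF_nonneg {lam : ℝ} (hlam : 0 < lam) (u : ℝ) : 0 ≤ fordSmoothF θ lam u := by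
  unfold fordSmoothF
  have := fordKernelW_nonneg hθ hθ' (lam * u)
  positivity

/-- The smoothing function vanishes for `u ≥ 2θ cot θ / λ`. [folklore] -/
theorem fordSmoothF_eq_zero {lam : ℝ} (hlam : 0 < lam) {u : ℝ} (hu : 2 * (θ * Real.cot θ) / lam ≤ u) :
    fordSmoothF θ lam u = 0 := by
  unfold fordSmoothF
  rw [fordKernelW_eq_zero_of_le_abs hθ hθ', mul_zero]
  rw [div_le_iff₀ hlam] at hu
  rw [abs_of_nonneg (by nlinarith [ford_cot_pos hθ hθ'])]
  linarith [mul_comm u lam]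

omit hθ hθ' in
/-- `f(0) = λ w(0)`. [folklore] -/
theorem fordSmoothF_zero (lam : ℝ) : fordSmoothF θ lam 0 = lam * fordKernelW θ 0 := by
  simp [fordSmoothF]

omit hθ hθ' in
/-- If `w` is `C¹` then so is `f(u) = λ e^{λu} w(λu)`. [folklore] -/
theorem contDiff_fordSmoothF (hw : ContDiff ℝ 1 (fordKernelW θ)) (lam : ℝ) :
    ContDiff ℝ 1 (fordSmoothF θ lam) := by
  unfold fordSmoothF
  exact ((contDiff_const.mul (Real.contDiff_exp.comp (contDiff_const.mul contDiff_id))).mul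
    (hw.comp (contDiff_const.mul contDiff_id)))

omit hθ hθ' in
/-- **`F(z) = W(z/λ − 1)`** (Ford (6.7)): the Laplace transform of `f(u) = λe^{λu}w(λu)` by the
substitution `v = λu`. [cite: Ford2002Millennium, (6.7)] -/
theorem fordLaplace_fordSmoothF {lam : ℝ} (hlam : 0 < lam) (z : ℂ) :
    fordLaplace (fordSmoothF θ lam) z = fordLaplaceWC θ (z / lam - 1) := by
  unfold fordLaplace fordLaplaceWC fordLaplace
  set G : ℝ → ℂ := fun x ↦ Complex.exp (-((z / lam - 1) * x)) * (fordKernelW θ x : ℂ) with hG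
  have hlamC : (lam : ℂ) ≠ 0 := by exact_mod_cast hlam.ne'
  have hpt : ∀ u : ℝ, Complex.exp (-(z * u)) * (fordSmoothF θ lam u : ℂ) = (lam : ℂ) * G (lam * u) := by
    intro u
    simp only [hG, fordSmoothF, Complex.ofReal_mul, Complex.ofReal_exp]
    have : Complex.exp (-((z / lam - 1) * ((lam : ℂ) * u))) = Complex.exp (-(z * u)) * Complex.exp (lam * u) := by
      rw [← Complex.exp_add]
      congr 1
      field_simp
      ring
    rw [this]
    ring
  simp_rw [hpt]
  rw [integral_const_mul, integral_comp_mul_left_Ioi G 0 hlam, mul_zero]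
  simp only [Complex.real_smul, Complex.ofReal_inv]
  rw [← mul_assoc, mul_inv_cancel₀ hlamC, one_mul]

end kernel

/-- For real `x`, the Laplace transform is the real integral `∫_0^∞ e^{-xu} f(u) du`. [folklore] -/
theorem fordLaplace_ofReal (f : ℝ → ℝ) (x : ℝ) :
    fordLaplace f x = ((∫ u in Set.Ioi (0 : ℝ), Real.exp (-(x * u)) * f u : ℝ) : ℂ) := by
  unfold fordLaplace
  rw [← integral_complex_ofReal]
  refine setIntegral_congr_fun measurableSet_Ioi fun u _ ↦ ?_
  push_cast
  rfl

/-- At real arguments the complex Laplace transform is the tree's real one: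
`W(x) = fordLaplaceW θ x`. [folklore] -/
theorem fordLaplaceWC_ofReal (θ x : ℝ) : fordLaplaceWC θ x = ((fordLaplaceW θ x : ℝ) : ℂ) := by
  unfold fordLaplaceWC fordLaplaceW
  exact fordLaplace_ofReal _ _

/-! ## `W` on `[0, 2θ cot θ]`: `W` is entire, and `Re W ≥ 0` on `Re z ≥ 0` (Ford (6.8)) — proved -/

section Wentire

variable {θ : ℝ} (hθ : 0 < θ) (hθ' : θ < π / 2)
include hθ hθ'

omit hθ hθ' in
/-- The two copies of the kernel in the tree agree: `fordW θ = fordKernelW θ`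
(`ExplicitZeroFreeRegionKernel.lean`, `VinogradovKorobovIntermediateInputs.lean`). [folklore] -/
theorem fordW_eq_fordKernelW (θ : ℝ) : fordW θ = fordKernelW θ := by
  funext u
  rw [fordKernelW_apply]
  rfl

omit hθ hθ' in
/-- `W(z) = ∫_0^{2θ cot θ} e^{-zu} w(u) du`: the kernel vanishes beyond `2θ cot θ`. [folklore] -/
theorem fordLaplaceWC_eq_intervalIntegral (hθc : 0 ≤ θ * Real.cot θ) (z : ℂ) :
    fordLaplaceWC θ z = ∫ u in (0 : ℝ)..(2 * (θ * Real.cot θ)),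
      Complex.exp (-(z * u)) * (fordKernelW θ u : ℂ) := by
  unfold fordLaplaceWC fordLaplace
  rw [intervalIntegral.integral_of_le (by linarith), ← Set.Ioi_inter_Iic, Set.inter_comm,
    ← Measure.restrict_restrict measurableSet_Iic, ← integral_indicator measurableSet_Iic]
  refine setIntegral_congr_fun measurableSet_Ioi fun u hu ↦ ?_
  by_cases h : u ≤ 2 * (θ * Real.cot θ)
  · rw [Set.indicator_of_mem (Set.mem_Iic.2 h)]
  · rw [Set.indicator_of_notMem (fun h' ↦ h (Set.mem_Iic.1 h'))]
    have hu0 : 0 < u := Set.mem_Ioi.1 hu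
    rw [fordKernelW_eq_zero (by rw [abs_of_pos hu0]; exact not_le.1 h)]
    simp

/-- **`W` is entire** (differentiation under the integral sign on `[0, 2θ cot θ]`; Ford §6 uses
`W` as an analytic function on `ℂ`). [folklore] -/
theorem differentiable_fordLaplaceWC : Differentiable ℂ (fordLaplaceWC θ) := by
  have ha := ford_cot_pos hθ hθ'
  set b : ℝ := 2 * (θ * Real.cot θ) with hb
  have hb0 : 0 ≤ b := by positivity
  have heq : fordLaplaceWC θ = fun z ↦ ∫ u in (0 : ℝ)..b, Complex.exp (-(z * u)) * (fordKernelW θ u : ℂ) := by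
    funext z; exact fordLaplaceWC_eq_intervalIntegral ha.le z
  rw [heq]
  obtain ⟨C, hC⟩ := (continuous_fordKernelW hθ hθ').bounded_above_of_compact_support
    hasCompactSupport_fordKernelW
  have hwc := continuous_fordKernelW hθ hθ'
  intro z₀
  have hcontF : ∀ z : ℂ, Continuous fun u : ℝ ↦ Complex.exp (-(z * u)) * (fordKernelW θ u : ℂ) := by
    intro z; fun_prop
  have hcontF' : Continuous fun u : ℝ ↦ Complex.exp (-(z₀ * u)) * -(1 * (u : ℂ)) * (fordKernelW θ u : ℂ) := by
    fun_prop
  have key := intervalIntegral.hasDerivAt_integral_of_dominated_loc_of_deriv_le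
    (𝕜 := ℂ) (μ := volume) (a := 0) (b := b) (x₀ := z₀)
    (F := fun z u ↦ Complex.exp (-(z * u)) * (fordKernelW θ u : ℂ))
    (F' := fun z u ↦ Complex.exp (-(z * u)) * -(1 * (u : ℂ)) * (fordKernelW θ u : ℂ))
    (bound := fun _ ↦ Real.exp ((‖z₀‖ + 1) * b) * b * C)
    (Metric.ball_mem_nhds z₀ one_pos)
    (Filter.Eventually.of_forall fun z ↦ (hcontF z).aestronglyMeasurable)
    ((hcontF z₀).intervalIntegrable _ _) hcontF'.aestronglyMeasurable ?_ intervalIntegrable_const ?_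
  · exact key.2.differentiableAt
  · refine Filter.Eventually.of_forall fun u hu z hz ↦ ?_
    rw [Set.uIoc_of_le hb0] at hu
    have hu0 : 0 ≤ u := hu.1.le
    have hub : u ≤ b := hu.2
    have hz' : ‖z‖ ≤ ‖z₀‖ + 1 := by
      have h1 := Metric.mem_ball.1 hz
      rw [dist_eq_norm] at h1
      linarith [norm_sub_norm_le z z₀]
    have hwu : |fordKernelW θ u| ≤ C := by simpa [Real.norm_eq_abs] using hC u
    have hC0 : 0 ≤ C := (abs_nonneg _).trans hwu
    rw [norm_mul, norm_mul, Complex.norm_exp, norm_neg, one_mul, Complex.norm_real, Complex.norm_real,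
      Real.norm_eq_abs, Real.norm_eq_abs, abs_of_nonneg hu0]
    have hre : (-(z * (u : ℂ))).re = -(z.re * u) := by
      simp [Complex.mul_re]
    have h1 : (-(z * (u : ℂ))).re ≤ (‖z₀‖ + 1) * b := by
      rw [hre]
      have h2 : -(z.re * u) ≤ ‖z‖ * u := by
        have := Complex.abs_re_le_norm z
        have := neg_abs_le z.re
        nlinarith
      nlinarith [norm_nonneg z]
    have hexp : Real.exp ((-(z * (u : ℂ))).re) ≤ Real.exp ((‖z₀‖ + 1) * b) := Real.exp_le_exp.2 h1
    have hA : Real.exp ((-(z * (u : ℂ))).re) * u ≤ Real.exp ((‖z₀‖ + 1) * b) * b :=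
      mul_le_mul hexp hub hu0 (Real.exp_pos _).le
    exact mul_le_mul hA hwu (abs_nonneg _) (by positivity)
  · refine Filter.Eventually.of_forall fun u _ z _ ↦ ?_
    exact (((hasDerivAt_id' z).mul_const (u : ℂ)).neg.cexp.mul_const _)

/-- **`Re W(z) ≥ 0` for `Re z ≥ 0`** (Ford (6.8): "`Re W(iy) = 2(∫ w cos)² ≥ 0` … maximum modulus";
Heath-Brown 1992, Lemma 7.1) — here from the tree's proof of Kadiri's (H₂) for the kernel
`h^{(1)}_{1,θ} = w` on `[0, 2θ cot θ]` (`mtyH1_laplace_re_nonneg'`, energy identity for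
`e^{−X|t|}`). [cite: Ford2002Millennium, (6.8)] -/
theorem re_fordLaplaceWC_nonneg {z : ℂ} (hz : 0 ≤ z.re) : 0 ≤ (fordLaplaceWC θ z).re := by
  have ha := ford_cot_pos hθ hθ'
  rw [fordLaplaceWC_eq_intervalIntegral ha.le]
  have hD : mtyD1 θ = 2 * (θ * Real.cot θ) := by unfold mtyD1; ring
  have h := mtyH1_laplace_re_nonneg' hθ hθ' hz z.im
  rw [Complex.re_add_im, hD] at h
  have hcongr : ∫ u in (0 : ℝ)..(2 * (θ * Real.cot θ)), Complex.exp (-(z * u)) * (fordKernelW θ u : ℂ)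
      = ∫ u in (0 : ℝ)..(2 * (θ * Real.cot θ)), (mtyH1 1 θ u : ℂ) * Complex.exp (-(z * u)) := by
    refine intervalIntegral.integral_congr fun u hu ↦ ?_
    rw [Set.uIcc_of_le (by positivity)] at hu
    have hw : fordKernelW θ u = mtyH1 1 θ u := by
      rw [← fordW_eq_fordKernelW, fordW_eq_mtyH1 hθ hθ' hu.1 hu.2]
    simp only [hw]
    ring
  rw [hcongr]
  exact h

end Wentire

/-! ## The bound `|W₀(z)| ≤ H(R)/|z|³` (Ford (7.4); MTY §4) — proved -/

section W0bound

variable {θ : ℝ} (hθ : 0 < θ) (hθ' : θ < π / 2)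
include hθ hθ'

omit hθ' in
/-- `θ ≥ sin θ cos θ` for `θ ≥ 0` (`sin 2θ ≤ 2θ`), whence `c₁, c₃ ≥ 0`. [folklore] -/
theorem sin_mul_cos_le_self : Real.sin θ * Real.cos θ ≤ θ := by
  have h := Real.sin_le (by linarith : 0 ≤ 2 * θ)
  rw [Real.sin_two_mul] at h
  linarith

/-- `c₀ > 0`. [folklore] -/
theorem fordC₀_pos : 0 < fordC₀ θ := by
  unfold fordC₀
  have := ford_sin_pos hθ hθ'
  have := ford_cos_pos hθ hθ'
  positivity

/-- `c₁ ≥ 0`. [folklore] -/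
theorem fordC₁_nonneg : 0 ≤ fordC₁ θ := by
  unfold fordC₁
  have := sin_mul_cos_le_self hθ
  have := ford_tan_pos hθ hθ'
  exact mul_nonneg (by linarith) (by positivity)

/-- `c₂ ≥ 0`. [folklore] -/
theorem fordC₂_nonneg : 0 ≤ fordC₂ θ := by
  unfold fordC₂
  have := ford_tan_pos hθ hθ'
  positivity

/-- `c₃ ≥ 0`. [folklore] -/
theorem fordC₃_nonneg : 0 ≤ fordC₃ θ := by
  unfold fordC₃
  have := sin_mul_cos_le_self hθ
  have := ford_tan_pos hθ hθ'
  exact mul_nonneg (by linarith) (by positivity)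

/-- `H(R) ≥ 0` for `R > 0`. [folklore] -/
theorem fordH_nonneg_of_pos {R : ℝ} (hR : 0 < R) : 0 ≤ fordH θ R := by
  unfold fordH
  have := fordC₀_pos hθ hθ'
  have := fordC₁_nonneg hθ hθ'
  have := fordC₂_nonneg hθ hθ'
  have := fordC₃_nonneg hθ hθ'
  positivity

/-- **`|W₀(z)| ≤ H(R)/|z|³` for `Re z ≥ −1`, `|z| ≥ R`** (`R ≥ 3 > tan θ`; Ford (7.4), MTY §4, display
after (4.6)): the numerator of `W₀` is at most
`|z|³ (c₂ ((R+1)²/R³)(e^{2θ cot θ} + 1) + c₁/R² + c₃)` (using `|e^{−2θ cot θ z}| ≤ e^{2θ cot θ}`,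
`(|z|+1)²/|z|³ ≤ (R+1)²/R³`) and the denominator at least `|z|⁶ (1 − tan²θ/R²)²`.
[cite: Ford2002Millennium, (7.4)] -/
theorem norm_fordLaplaceW0_le {R : ℝ} (hR : 3 ≤ R) (htan : Real.tan θ < R) {z : ℂ}
    (hz : -1 ≤ z.re) (hzR : R ≤ ‖z‖) :
    ‖fordLaplaceW0 θ z‖ ≤ fordH θ R / ‖z‖ ^ 3 := by
  have hR0 : 0 < R := by linarith
  set r : ℝ := ‖z‖ with hr
  have hr0 : 0 < r := hR0.trans_le hzR
  have htan0 := ford_tan_pos hθ hθ'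
  have ha := ford_cot_pos hθ hθ'
  -- the constants
  set κ : ℝ := 1 - Real.tan θ ^ 2 / R ^ 2 with hκ
  have hκ0 : 0 < κ := by
    rw [hκ, sub_pos, div_lt_one (by positivity)]
    exact pow_lt_pow_left₀ htan htan0.le two_ne_zero
  have hκ1 : κ ≤ 1 - Real.tan θ ^ 2 / r ^ 2 := by
    rw [hκ]
    gcongr
  set B₁ : ℝ := fordC₂ θ * ((R + 1) ^ 2 / R ^ 3) * (Real.exp (2 * θ * Real.cot θ) + 1)
      + fordC₁ θ / R ^ 2 + fordC₃ θ with hB₁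
  have hH : fordH θ R = fordC₀ θ / κ ^ 2 * B₁ := rfl
  -- numerator bound
  have hexp : ‖Complex.exp (-(((2 * θ * Real.cot θ : ℝ) : ℂ) * z))‖ ≤ Real.exp (2 * θ * Real.cot θ) := by
    rw [Complex.norm_exp, Real.exp_le_exp]
    simp only [Complex.neg_re, Complex.re_ofReal_mul]
    nlinarith
  have hz1 : ‖z + 1‖ ≤ r + 1 := by
    calc ‖z + 1‖ ≤ ‖z‖ + ‖(1 : ℂ)‖ := norm_add_le _ _
      _ = r + 1 := by rw [norm_one]
  have hgeom : (r + 1) ^ 2 ≤ r ^ 3 * ((R + 1) ^ 2 / R ^ 3) := by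
    rw [mul_div_assoc', le_div_iff₀ (by positivity)]
    have h1 : R ≤ r := hzR
    have h2 : 0 ≤ r - R := by linarith
    nlinarith [mul_nonneg h2 (by positivity : (0:ℝ) ≤ r * R), mul_nonneg h2 (by positivity : (0:ℝ) ≤ r),
      mul_nonneg h2 (by positivity : (0:ℝ) ≤ R), mul_nonneg h2 (by positivity : (0:ℝ) ≤ r * R * (r + R))]
  have hnum : ‖(fordC₂ θ : ℂ) * ((z + 1) ^ 2 * Complex.exp (-(((2 * θ * Real.cot θ : ℝ) : ℂ) * z)) + z ^ 2 - 1)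
        - (fordC₁ θ : ℂ) * z - (fordC₃ θ : ℂ) * z ^ 3‖ ≤ r ^ 3 * B₁ := by
    have hc1 := fordC₁_nonneg hθ hθ'
    have hc2 := fordC₂_nonneg hθ hθ'
    have hc3 := fordC₃_nonneg hθ hθ'
    have hA : ‖(z + 1) ^ 2 * Complex.exp (-(((2 * θ * Real.cot θ : ℝ) : ℂ) * z)) + z ^ 2 - 1‖
        ≤ (r + 1) ^ 2 * (Real.exp (2 * θ * Real.cot θ) + 1) := by
      calc ‖(z + 1) ^ 2 * Complex.exp (-(((2 * θ * Real.cot θ : ℝ) : ℂ) * z)) + z ^ 2 - 1‖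
          ≤ ‖(z + 1) ^ 2 * Complex.exp (-(((2 * θ * Real.cot θ : ℝ) : ℂ) * z))‖ + ‖z ^ 2‖ + ‖(1 : ℂ)‖ :=
            norm_sub_le_of_le (norm_add_le _ _) le_rfl
        _ ≤ (r + 1) ^ 2 * Real.exp (2 * θ * Real.cot θ) + r ^ 2 + 1 := by
            rw [norm_mul, norm_pow, norm_pow, norm_one]
            gcongr
        _ ≤ (r + 1) ^ 2 * (Real.exp (2 * θ * Real.cot θ) + 1) := by nlinarith [Real.exp_pos (2 * θ * Real.cot θ)]
    calc ‖(fordC₂ θ : ℂ) * ((z + 1) ^ 2 * Complex.exp (-(((2 * θ * Real.cot θ : ℝ) : ℂ) * z)) + z ^ 2 - 1)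
          - (fordC₁ θ : ℂ) * z - (fordC₃ θ : ℂ) * z ^ 3‖
        ≤ ‖(fordC₂ θ : ℂ) * ((z + 1) ^ 2 * Complex.exp (-(((2 * θ * Real.cot θ : ℝ) : ℂ) * z)) + z ^ 2 - 1)‖
          + ‖(fordC₁ θ : ℂ) * z‖ + ‖(fordC₃ θ : ℂ) * z ^ 3‖ := norm_sub_le_of_le (norm_sub_le _ _) le_rfl
      _ = fordC₂ θ * ‖(z + 1) ^ 2 * Complex.exp (-(((2 * θ * Real.cot θ : ℝ) : ℂ) * z)) + z ^ 2 - 1‖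
          + fordC₁ θ * r + fordC₃ θ * r ^ 3 := by
            simp only [norm_mul, norm_pow, Complex.norm_real, Real.norm_eq_abs, abs_of_nonneg hc1,
              abs_of_nonneg hc2, abs_of_nonneg hc3, hr]
      _ ≤ fordC₂ θ * (r ^ 3 * ((R + 1) ^ 2 / R ^ 3) * (Real.exp (2 * θ * Real.cot θ) + 1))
          + fordC₁ θ * (r ^ 3 / R ^ 2) + fordC₃ θ * r ^ 3 := by
            gcongr
            · calc ‖(z + 1) ^ 2 * Complex.exp (-(((2 * θ * Real.cot θ : ℝ) : ℂ) * z)) + z ^ 2 - 1‖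
                  ≤ (r + 1) ^ 2 * (Real.exp (2 * θ * Real.cot θ) + 1) := hA
                _ ≤ _ := by gcongr
            · rw [le_div_iff₀ (by positivity)]
              have : R ^ 2 ≤ r ^ 2 := pow_le_pow_left₀ hR0.le hzR 2
              nlinarith
      _ = r ^ 3 * B₁ := by rw [hB₁]; ring
  -- denominator bound
  have htanC : ‖((Real.tan θ : ℂ)) ^ 2‖ = Real.tan θ ^ 2 := by
    rw [norm_pow, Complex.norm_real, Real.norm_eq_abs, abs_of_pos htan0]
  have hden1 : r ^ 2 * κ ≤ ‖z ^ 2 + (Real.tan θ : ℂ) ^ 2‖ := by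
    have h := norm_sub_norm_le (z ^ 2) (-((Real.tan θ : ℂ) ^ 2))
    rw [sub_neg_eq_add, norm_neg, htanC, norm_pow, ← hr] at h
    calc r ^ 2 * κ ≤ r ^ 2 * (1 - Real.tan θ ^ 2 / r ^ 2) := by gcongr
      _ = r ^ 2 - Real.tan θ ^ 2 := by field_simp
      _ ≤ _ := h
  have hden : r ^ 6 * κ ^ 2 ≤ ‖z ^ 2 * (z ^ 2 + (Real.tan θ : ℂ) ^ 2) ^ 2‖ := by
    rw [norm_mul, norm_pow, norm_pow, ← hr]
    calc r ^ 6 * κ ^ 2 = r ^ 2 * (r ^ 2 * κ) ^ 2 := by ring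
      _ ≤ r ^ 2 * ‖z ^ 2 + (Real.tan θ : ℂ) ^ 2‖ ^ 2 := by gcongr
  have hden0 : 0 < ‖z ^ 2 * (z ^ 2 + (Real.tan θ : ℂ) ^ 2) ^ 2‖ := lt_of_lt_of_le (by positivity) hden
  -- assemble
  unfold fordLaplaceW0
  rw [norm_div, norm_mul, Complex.norm_real, Real.norm_eq_abs, abs_of_pos (fordC₀_pos hθ hθ'),
    div_le_div_iff₀ hden0 (by positivity), hH]
  calc fordC₀ θ * ‖(fordC₂ θ : ℂ) * ((z + 1) ^ 2 * Complex.exp (-(((2 * θ * Real.cot θ : ℝ) : ℂ) * z)) + z ^ 2 - 1)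
          - (fordC₁ θ : ℂ) * z - (fordC₃ θ : ℂ) * z ^ 3‖ * r ^ 3
      ≤ fordC₀ θ * (r ^ 3 * B₁) * r ^ 3 := by gcongr; exact (fordC₀_pos hθ hθ').le
    _ = fordC₀ θ / κ ^ 2 * B₁ * (r ^ 6 * κ ^ 2) := by field_simp
    _ ≤ fordC₀ θ / κ ^ 2 * B₁ * ‖z ^ 2 * (z ^ 2 + (Real.tan θ : ℂ) ^ 2) ^ 2‖ := by
        have : 0 ≤ fordC₀ θ / κ ^ 2 * B₁ := by
          have := fordC₀_pos hθ hθ'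
          have := fordC₁_nonneg hθ hθ'
          have := fordC₂_nonneg hθ hθ'
          have := fordC₃_nonneg hθ hθ'
          positivity
        gcongr

end W0bound

/-! ## Ford's Lemma 4.4: `Re(cot z − 1/z) ≥ −4 Re z/π²` for `Re z ≥ 0`, `|z| ≤ π/2` — proved

Ford proves this by the maximum principle; we use the partial-fraction expansion
`cot z − 1/z = Σ_{m ≥ 1} 2z/(z² − m²π²)` (Mathlib's `cot_series_rep'`): each term has real part
`≥ −2 Re z/(m²π² − |z|²) ≥ −(2 Re z/π²)(1/(m − 1/2) − 1/(m + 1/2))`, and the series telescopes to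
`−4 Re z/π²`. -/

/-- `Σ_{n ≥ 0} (1/(n + 1/2) − 1/(n + 3/2)) = 2` (telescoping). [folklore] -/
theorem hasSum_telescope_half :
    HasSum (fun n : ℕ ↦ 1 / ((n : ℝ) + 1 / 2) - 1 / ((n : ℝ) + 3 / 2)) 2 := by
  have hpart : ∀ N : ℕ, ∑ n ∈ Finset.range N, (1 / ((n : ℝ) + 1 / 2) - 1 / ((n : ℝ) + 3 / 2))
      = 2 - 1 / ((N : ℝ) + 1 / 2) := by
    intro N
    induction N with
    | zero => norm_num
    | succ N ih =>
      rw [Finset.sum_range_succ, ih]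
      have h1 : (N : ℝ) + 1 / 2 ≠ 0 := by positivity
      have h2 : (N : ℝ) + 3 / 2 ≠ 0 := by positivity
      have h3 : ((N + 1 : ℕ) : ℝ) + 1 / 2 ≠ 0 := by positivity
      push_cast
      field_simp
      ring
  have hnonneg : ∀ n : ℕ, 0 ≤ 1 / ((n : ℝ) + 1 / 2) - 1 / ((n : ℝ) + 3 / 2) := by
    intro n
    rw [sub_nonneg]
    gcongr
    norm_num
  rw [hasSum_iff_tendsto_nat_of_nonneg hnonneg]
  simp_rw [hpart]
  have h1 : Tendsto (fun N : ℕ ↦ 1 / ((N : ℝ) + 1 / 2)) atTop (𝓝 0) :=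
    tendsto_const_nhds.div_atTop (tendsto_natCast_atTop_atTop.atTop_add tendsto_const_nhds)
  simpa using tendsto_const_nhds.sub h1

/-- The real-variable core of Ford's Lemma 4.4: for `a ≥ 0`, `a² + b² ≤ 1/4`, `m ≥ 1`,
`(a − m)/((a − m)² + b²) + (a + m)/((a + m)² + b²) ≥ −2a (1/(m − 1/2) − 1/(m + 1/2))`. [folklore] -/
theorem re_pair_ge (a b m : ℝ) (ha : 0 ≤ a) (hab : a ^ 2 + b ^ 2 ≤ 1 / 4) (hm : 1 ≤ m) :
    -(2 * a) * (1 / (m - 1 / 2) - 1 / (m + 1 / 2)) ≤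
      (a - m) / ((a - m) ^ 2 + b ^ 2) + (a + m) / ((a + m) ^ 2 + b ^ 2) := by
  set s : ℝ := m ^ 2 - a ^ 2 - b ^ 2 with hs
  have hs0 : m ^ 2 - 1 / 4 ≤ s := by rw [hs]; linarith
  have hm0 : 0 < m ^ 2 - 1 / 4 := by nlinarith
  have hs1 : 0 < s := hm0.trans_le hs0
  have ham : a < m := by nlinarith
  have hD1 : 0 < (a - m) ^ 2 + b ^ 2 := by nlinarith
  have hD2 : 0 < (a + m) ^ 2 + b ^ 2 := by nlinarith
  have key : (a - m) / ((a - m) ^ 2 + b ^ 2) + (a + m) / ((a + m) ^ 2 + b ^ 2)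
      = -(2 * a) * s / (s ^ 2 + 4 * b ^ 2 * m ^ 2) := by
    have hprod : ((a - m) ^ 2 + b ^ 2) * ((a + m) ^ 2 + b ^ 2) = s ^ 2 + 4 * b ^ 2 * m ^ 2 := by
      rw [hs]; ring
    rw [div_add_div _ _ hD1.ne' hD2.ne', hprod]
    congr 1
    rw [hs]; ring
  have htel : 1 / (m - 1 / 2) - 1 / (m + 1 / 2) = 1 / (m ^ 2 - 1 / 4) := by
    have h1 : m - 1 / 2 ≠ 0 := by linarith
    have h2 : m + 1 / 2 ≠ 0 := by linarith
    rw [div_sub_div _ _ h1 h2]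
    congr 1 <;> ring
  rw [key, htel]
  have hsq : 0 < s ^ 2 + 4 * b ^ 2 * m ^ 2 := by positivity
  calc -(2 * a) * (1 / (m ^ 2 - 1 / 4)) = -(2 * a / (m ^ 2 - 1 / 4)) := by ring
    _ ≤ -(2 * a / s) := by
        rw [neg_le_neg_iff]
        exact div_le_div_of_nonneg_left (by positivity) hm0 hs0
    _ ≤ -(2 * a) * s / (s ^ 2 + 4 * b ^ 2 * m ^ 2) := by
        rw [neg_mul, neg_div, neg_le_neg_iff, div_le_div_iff₀ hsq hs1]
        nlinarith [mul_nonneg (mul_nonneg ha (sq_nonneg b)) (sq_nonneg m)]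

/-- **Ford 2002, Lemma 4.4** (in the form used): for `Re z ≥ 0` and `|z| ≤ π/2`,
`Re(cot z − 1/z) ≥ −4 Re z/π²`, i.e. `Re(cot z − 1/z + 4z/π²) ≥ 0`.
[cite: Ford2002Millennium, Lemma 4.4] -/
theorem re_cot_sub_inv_ge {z : ℂ} (hz : 0 ≤ z.re) (hzn : ‖z‖ ≤ π / 2) :
    -(4 * z.re / π ^ 2) ≤ (Complex.cot z - 1 / z).re := by
  rcases eq_or_ne z 0 with rfl | hz0
  · simp [Complex.cot]
  have hπ0 : (0 : ℝ) < π := Real.pi_pos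
  have hπ : (π : ℂ) ≠ 0 := by exact_mod_cast hπ0.ne'
  set x : ℂ := z / π with hx
  have hzx : (π : ℂ) * x = z := by rw [hx]; field_simp
  have hxre : x.re = z.re / π := by
    rw [hx, div_eq_mul_inv, ← Complex.ofReal_inv, mul_comm, Complex.re_ofReal_mul]; ring
  have hxim : x.im = z.im / π := by
    rw [hx, div_eq_mul_inv, ← Complex.ofReal_inv, mul_comm, Complex.im_ofReal_mul]; ring
  have hxn : x.re ^ 2 + x.im ^ 2 ≤ 1 / 4 := by
    have h1 : x.re ^ 2 + x.im ^ 2 = ‖z‖ ^ 2 / π ^ 2 := by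
      rw [hxre, hxim, div_pow, div_pow, ← add_div, Complex.sq_norm, Complex.normSq_apply]; ring
    rw [h1, div_le_iff₀ (by positivity)]
    nlinarith [norm_nonneg z]
  have hxI : x ∈ Complex.integerComplement := by
    rw [Complex.mem_integerComplement_iff]
    rintro ⟨n, hn⟩
    have hn0 : n ≠ 0 := by
      rintro rfl
      apply hz0
      rw [← hzx, ← hn]
      simp
    have h1 : (1 : ℝ) ≤ |(n : ℝ)| := by exact_mod_cast Int.one_le_abs hn0
    have h2 : x.re = n := by rw [← hn]; simp
    have h3 : (n : ℝ) ^ 2 ≤ 1 / 4 := by rw [← h2]; nlinarith [sq_nonneg x.im]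
    nlinarith [sq_abs (n : ℝ), mul_le_mul h1 h1 zero_le_one (abs_nonneg _)]
  have hsum := summable_cotTerm hxI
  have hrep := cot_series_rep' hxI
  -- real parts of the terms
  have hterm : ∀ n : ℕ, -(2 * x.re) * (1 / ((n : ℝ) + 1 / 2) - 1 / ((n : ℝ) + 3 / 2))
      ≤ (1 / (x - (n + 1)) + 1 / (x + (n + 1))).re := by
    intro n
    have e1 : (1 / (x - (n + 1)) + 1 / (x + (n + 1))).re
        = (x.re - (n + 1)) / ((x.re - (n + 1)) ^ 2 + x.im ^ 2)
          + (x.re + (n + 1)) / ((x.re + (n + 1)) ^ 2 + x.im ^ 2) := by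
      simp only [one_div, Complex.add_re, Complex.inv_re, Complex.normSq_apply, Complex.sub_re,
        Complex.sub_im, Complex.add_im, Complex.natCast_re, Complex.natCast_im, Complex.one_re,
        Complex.one_im]
      ring
    have h := re_pair_ge x.re x.im ((n : ℝ) + 1) (by rw [hxre]; positivity) hxn (by linarith [n.cast_nonneg (α := ℝ)])
    rw [e1]
    convert h using 2; ring
  have hle : -(2 * x.re) * 2 ≤ (↑π * Complex.cot (↑π * x) - 1 / x).re := by
    rw [hrep]
    exact hasSum_le hterm (hasSum_telescope_half.mul_left _) (Complex.hasSum_re hsum.hasSum)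
  -- back to `z`
  have hid : (↑π * Complex.cot (↑π * x) - 1 / x) = ↑π * (Complex.cot z - 1 / z) := by
    rw [hzx, hx]; field_simp
  rw [hid, Complex.re_ofReal_mul, hxre] at hle
  rw [show -(4 * z.re / π ^ 2) = (-(2 * (z.re / π)) * 2) / π by field_simp; ring]
  rw [div_le_iff₀ hπ0]
  linarith

/-! ## Two elementary inequalities of Ford's §7 -/

/-- `cot x − 1/x ≥ −0.348 x` for `0 < x ≤ π/4` (Ford 2002, §7, before (7.8); from the Taylor
brackets `cos x ≥ 1 − x²/2 + x⁴/24 − x⁶/720`, `sin x ≤ x − x³/6 + x⁵/120`).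
[cite: Ford2002Millennium, §7 (proof of Lemma 7.1)] -/
theorem cot_sub_inv_ge_real {x : ℝ} (hx : 0 < x) (hx' : x ≤ π / 4) :
    -0.348 * x ≤ Real.cot x - 1 / x := by
  have hπ := Real.pi_lt_d6
  have hx1 : x ≤ 0.7853983 := by linarith
  have hx2 : x ^ 2 ≤ 0.61686 := by nlinarith
  have hc := (VK.cos_taylor_brackets hx.le (by linarith) 2).1
  have hs := (VK.sin_taylor_brackets hx.le (by linarith) 1).2
  simp only [Finset.sum_range_succ, Finset.sum_range_zero, Nat.factorial] at hc hs
  norm_num at hc hs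
  have hsin : 0 < Real.sin x := Real.sin_pos_of_pos_of_lt_pi hx (by linarith)
  rw [Real.cot_eq_cos_div_sin, div_sub_div _ _ hsin.ne' hx.ne', le_div_iff₀ (by positivity)]
  -- goal: -0.348 * x * (sin x * x) ≤ cos x * x - sin x * 1  (up to normalisation)
  have hpoly : (x - x ^ 3 / 6 + x ^ 5 / 120) * (1 - 0.348 * x ^ 2)
      ≤ x * (1 - x ^ 2 / 2 + x ^ 4 / 24 - x ^ 6 / 720) := by
    have hy0 : 0 ≤ x ^ 2 := sq_nonneg x
    nlinarith [mul_nonneg hx.le hy0, mul_nonneg (mul_nonneg hx.le hy0) hy0,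
      mul_nonneg (mul_nonneg hx.le hy0) (sub_nonneg.2 hx2), mul_nonneg (mul_nonneg (mul_nonneg hx.le hy0) hy0) (sub_nonneg.2 hx2)]
  have h1 : Real.sin x * (1 - 0.348 * x ^ 2) ≤ (x - x ^ 3 / 6 + x ^ 5 / 120) * (1 - 0.348 * x ^ 2) :=
    mul_le_mul_of_nonneg_right hs (by nlinarith)
  have h2 : x * (1 - x ^ 2 / 2 + x ^ 4 / 24 - x ^ 6 / 720) ≤ x * Real.cos x :=
    mul_le_mul_of_nonneg_left (by linarith) hx.le
  nlinarith

/-- `1.8/b ≤ 0.6` for `b ≥ 3`, whence `206.7 + 1.8 + 1.8 b₀/b ≤ 209.1` for `P₄₀` (`b₀ = 1`,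
`b = 3.5645…`); the constant `209.1` of MTY Lemma 4.7. [cite: MossinghoffTrudgianYangRNT2024, Lemma 4.7] -/
theorem mty_const_209 {b : ℝ} (hb : 3 ≤ b) : 206.7 + 1.8 + 1.8 / b ≤ 209.1 := by
  have : 1.8 / b ≤ 0.6 := by rw [div_le_iff₀ (by linarith)]; linarith
  linarith

/-! ## Locating the angle: every solution of (4.1) for `P₄₀` has `θ < 1.249`, so `tan θ < 3 ≤ R` -/

/-- `sin 1.249 ∈ [0.9486688225, 0.9486688226]`. [folklore] -/
theorem sin_1249_bounds : 0.9486688225 ≤ Real.sin 1.249 ∧ Real.sin 1.249 ≤ 0.9486688226 := by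
  have h := VK.sin_taylor_brackets (r := 1.249) (by norm_num) (by norm_num) 5
  simp only [Finset.sum_range_succ, Finset.sum_range_zero, Nat.factorial] at h
  norm_num at h
  constructor <;> linarith [h.1, h.2]

/-- `cos 1.249 ∈ [0.3162711891, 0.3162711892]`. [folklore] -/
theorem cos_1249_bounds : 0.3162711891 ≤ Real.cos 1.249 ∧ Real.cos 1.249 ≤ 0.3162711892 := by
  have h := VK.cos_taylor_brackets (r := 1.249) (by norm_num) (by norm_num) 5
  simp only [Finset.sum_range_succ, Finset.sum_range_zero, Nat.factorial] at h
  norm_num at h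
  constructor <;> linarith [h.1, h.2]

/-- `sin 1.32 ∈ [0.9687151001, 0.9687151002]`. [folklore] -/
theorem sin_132_bounds : 0.9687151001 ≤ Real.sin 1.32 ∧ Real.sin 1.32 ≤ 0.9687151002 := by
  have h := VK.sin_taylor_brackets (r := 1.32) (by norm_num) (by norm_num) 5
  simp only [Finset.sum_range_succ, Finset.sum_range_zero, Nat.factorial] at h
  norm_num at h
  constructor <;> linarith [h.1, h.2]

/-- `cos 1.32 ∈ [0.2481754516, 0.2481754517]`. [folklore] -/
theorem cos_132_bounds : 0.2481754516 ≤ Real.cos 1.32 ∧ Real.cos 1.32 ≤ 0.2481754517 := by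
  have h := VK.cos_taylor_brackets (r := 1.32) (by norm_num) (by norm_num) 5
  simp only [Finset.sum_range_succ, Finset.sum_range_zero, Nat.factorial] at h
  norm_num at h
  constructor <;> linarith [h.1, h.2]

/-- **Every solution `θ ∈ (0, π/2)` of (4.1), `sin²θ = r(1 − θ cot θ)`, with `r ≥ 1.746` has
`θ < 1.249`.** (For `θ ∈ [1.249, 1.32]`, `r(sin θ − θ cos θ) ≥ 1.746(sin 1.249 − 1.32 cos 1.249)
> sin³ 1.32 ≥ sin³θ`; for `θ ∈ [1.32, π/2)`, `r(sin θ − θ cos θ) > 1 ≥ sin³θ`; but (4.1) says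
`sin³θ = r(sin θ − θ cos θ)`.) For `P₄₀`, `r = b₁/b₀ = 1.74600…` and `θ = 1.13331…` (4.2).
[cite: MossinghoffTrudgianYangRNT2024, (4.1)–(4.2)] -/
theorem fordTheta_lt {r θ : ℝ} (hr : 1.746 ≤ r) (h : IsFordTheta 1 r θ) : θ < 1.249 := by
  obtain ⟨h0, h1, heq⟩ := h
  have hπ := Real.pi_lt_d6
  have hπ' := Real.pi_gt_d6
  have hs : 0 < Real.sin θ := Real.sin_pos_of_pos_of_lt_pi h0 (by linarith)
  have hcos : 0 ≤ Real.cos θ := Real.cos_nonneg_of_mem_Icc ⟨by linarith, h1.le⟩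
  -- (4.1) cleared of denominators
  have hcube : Real.sin θ ^ 3 = r * (Real.sin θ - θ * Real.cos θ) := by
    rw [div_one, Real.cot_eq_cos_div_sin] at heq
    have : Real.sin θ ^ 2 * Real.sin θ = r * (1 - θ * (Real.cos θ / Real.sin θ)) * Real.sin θ := by
      rw [heq]
    field_simp at this
    linear_combination this
  by_contra hθ
  rw [not_lt] at hθ
  obtain ⟨hS1, -⟩ := sin_1249_bounds
  obtain ⟨-, hC1⟩ := cos_1249_bounds
  obtain ⟨hS2, hS2'⟩ := sin_132_bounds
  obtain ⟨-, hC2⟩ := cos_132_bounds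
  have hsin_ge : Real.sin 1.249 ≤ Real.sin θ :=
    Real.sin_le_sin_of_le_of_le_pi_div_two (by linarith) h1.le hθ
  have hcos_le : Real.cos θ ≤ Real.cos 1.249 :=
    Real.cos_le_cos_of_nonneg_of_le_pi (by norm_num) (by linarith) hθ
  have hsin1 : Real.sin θ ≤ 1 := Real.sin_le_one θ
  rcases le_or_gt θ 1.32 with hθ2 | hθ2
  · -- θ ∈ [1.249, 1.32]
    have hsin_le : Real.sin θ ≤ Real.sin 1.32 :=
      Real.sin_le_sin_of_le_of_le_pi_div_two (by linarith) (by linarith) hθ2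
    have hcube_le : Real.sin θ ^ 3 ≤ 0.9687151002 ^ 3 :=
      pow_le_pow_left₀ hs.le (hsin_le.trans hS2') 3
    have hθcos : θ * Real.cos θ ≤ 1.32 * 0.3162711892 := by
      calc θ * Real.cos θ ≤ 1.32 * Real.cos θ := mul_le_mul_of_nonneg_right hθ2 hcos
        _ ≤ 1.32 * 0.3162711892 := by nlinarith
    have hlow : 1.746 * (0.9486688225 - 1.32 * 0.3162711892) ≤ r * (Real.sin θ - θ * Real.cos θ) := by
      have hpos : 0 ≤ Real.sin θ - θ * Real.cos θ := by linarith
      calc 1.746 * (0.9486688225 - 1.32 * 0.3162711892)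
          ≤ 1.746 * (Real.sin θ - θ * Real.cos θ) := by
            apply mul_le_mul_of_nonneg_left _ (by norm_num); linarith
        _ ≤ r * (Real.sin θ - θ * Real.cos θ) := mul_le_mul_of_nonneg_right hr hpos
    rw [← hcube] at hlow
    norm_num at hlow hcube_le
    linarith
  · -- θ ∈ (1.32, π/2)
    have hsin_ge2 : Real.sin 1.32 ≤ Real.sin θ :=
      Real.sin_le_sin_of_le_of_le_pi_div_two (by linarith) h1.le hθ2.le
    have hcos_le2 : Real.cos θ ≤ Real.cos 1.32 :=
      Real.cos_le_cos_of_nonneg_of_le_pi (by norm_num) (by linarith) hθ2.le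
    have hθcos : θ * Real.cos θ ≤ 1.5708 * 0.2481754517 := by
      calc θ * Real.cos θ ≤ 1.5708 * Real.cos θ := mul_le_mul_of_nonneg_right (by linarith) hcos
        _ ≤ 1.5708 * 0.2481754517 := by nlinarith
    have hlow : 1.746 * (0.9687151001 - 1.5708 * 0.2481754517) ≤ r * (Real.sin θ - θ * Real.cos θ) := by
      have hpos : 0 ≤ Real.sin θ - θ * Real.cos θ := by linarith
      calc 1.746 * (0.9687151001 - 1.5708 * 0.2481754517)
          ≤ 1.746 * (Real.sin θ - θ * Real.cos θ) := by
            apply mul_le_mul_of_nonneg_left _ (by norm_num); linarith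
        _ ≤ r * (Real.sin θ - θ * Real.cos θ) := mul_le_mul_of_nonneg_right hr hpos
    rw [← hcube] at hlow
    have hcube1 : Real.sin θ ^ 3 ≤ 1 := pow_le_one₀ hs.le hsin1
    norm_num at hlow
    linarith

/-- Hence `tan θ < 3` for every solution of (4.1) with `r ≥ 1.746` (`tan 1.249 = 2.9995…`).
[cite: MossinghoffTrudgianYangRNT2024, (4.1)–(4.2)] -/
theorem tan_fordTheta_lt_three {r θ : ℝ} (hr : 1.746 ≤ r) (h : IsFordTheta 1 r θ) : Real.tan θ < 3 := by
  have hlt := fordTheta_lt hr h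
  have hπ := Real.pi_gt_d6
  obtain ⟨-, hS1⟩ := sin_1249_bounds
  obtain ⟨hC1, -⟩ := cos_1249_bounds
  have h1 : Real.tan θ < Real.tan 1.249 :=
    Real.tan_lt_tan_of_lt_of_lt_pi_div_two (by linarith [h.1]) (by linarith) hlt
  have h2 : Real.tan 1.249 ≤ 3 := by
    rw [Real.tan_eq_sin_div_cos, div_le_iff₀ (by linarith)]
    linarith
  linarith

/-- For `P₄₀`: `b₁/b₀ = mtyB40 1 ≥ 1.746` (indeed `= 1.74600190914994…`, (3.6)).
[cite: MossinghoffTrudgianYangRNT2024, (3.6)] -/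
theorem mtyB40_one_ge : 1.746 ≤ mtyB40 1 := by
  have h := mtyB40_one_near
  rw [abs_le] at h
  linarith [h.1]

/-- For `P₄₀`: `b = Σ_{k=1}^{40} b_k ≥ 3.5` (indeed `= 3.56453965437134…`, (3.6)).
[cite: MossinghoffTrudgianYangRNT2024, (3.6)] -/
theorem mtyB40Sum_ge : 3.5 ≤ mtyB40Sum := by
  have h := mtyB40_sum_near
  rw [abs_le] at h
  unfold mtyB40Sum
  linarith [h.1]

/-! ## The two remaining kernel facts the assembly consumes (Ford (7.2)–(7.3) = MTY (4.4); `w ∈ C¹`)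

These are statements about the explicitly defined objects `fordKernelW θ` (`w = g ∗ g`) and
`fordLaplaceWC θ` (`W`). They are calculus (the closed form of `w` on `[0, 2θ cot θ]` is the tree's
`fordKernelW_eq_explicit` / `fordW_eq_mtyH1`; what remains is to differentiate it once more with
matching one-sided derivatives at `0` and `±2θ cot θ`, and to integrate `e^{−zu}` against it —
"The function `W(z)` has the explicit formula (found with the aid of Maple)", Ford §7); they are
NOT proved in this file, and enter the assembly below as the explicit hypothesis
`FordKernelFacts θ` (a predicate on `θ`; no new named fact is introduced). -/

/-- The two kernel facts of Ford §§6–7 / MTY §4 for the angle `θ` that the proof of Lemma 7.1 /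
Lemma 4.7 consumes and that are not (yet) theorems of the tree: `w = g ∗ g ∈ C¹(ℝ)` (the
regularity of the smoothing function assumed in Ford's Lemma 4.5 / MTY Lemma 4.2), and the closed
form `W(z) = w(0)/z + W₀(z)` at complex `z` (Ford (7.2)–(7.3), "found with the aid of Maple"; MTY
(4.4)). (The other kernel inputs — `w(0)`, `W(0)`, `W(−1)` (Ford (6.5)), `W'(0)` (MTY (4.6)),
`W(0) − W(x) ≤ x|W'(0)|`, `Re W ≥ 0` on `Re z ≥ 0` (Ford (6.8)), `W` entire — are theorems, of
`VinogradovKorobovIntermediateInputs.lean`, `ExplicitZeroFreeRegionLaplace.lean` and this file.)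
[cite: Ford2002Millennium, (7.2)–(7.3)] [cite: MossinghoffTrudgianYangRNT2024, (4.4)] -/
structure FordKernelFacts (θ : ℝ) : Prop where
  /-- `w = g ∗ g` is continuously differentiable (Ford §6 / Lemma 4.5). [cite: Ford2002Millennium, Lemma 4.5] -/
  contDiff : ContDiff ℝ 1 (fordKernelW θ)
  /-- `W(z) = w(0)/z + W₀(z)` off the poles of the closed form (Ford (7.2)–(7.3); MTY (4.4)).
  [cite: Ford2002Millennium, (7.2)–(7.3)] -/
  closed_form : ∀ z : ℂ, z ≠ 0 → z ^ 2 + (Real.tan θ : ℂ) ^ 2 ≠ 0 →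
    fordLaplaceWC θ z = (fordSmoothW0 θ : ℂ) / z + fordLaplaceW0 θ z

/-! ## `|F₀(z)| ≤ C₅(R) λ f(0)/|z|²` (Ford (7.5)–(7.6); MTY (4.7)) — proved from the closed form -/

section F0bound

variable {θ : ℝ} (hθ : 0 < θ) (hθ' : θ < π / 2)
include hθ hθ'

/-- Off the disc `|z| < R` (`R > tan θ`) the closed form applies: `z ≠ 0` and `z² + tan²θ ≠ 0`.
[folklore] -/
theorem closed_form_hyps {R : ℝ} (htan : Real.tan θ < R) {z : ℂ} (hzR : R ≤ ‖z‖) :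
    z ≠ 0 ∧ z ^ 2 + (Real.tan θ : ℂ) ^ 2 ≠ 0 := by
  have htan0 := ford_tan_pos hθ hθ'
  have hz0 : 0 < ‖z‖ := htan0.trans (htan.trans_le hzR)
  refine ⟨norm_pos_iff.1 hz0, fun h ↦ ?_⟩
  have h1 : z ^ 2 = -((Real.tan θ : ℂ) ^ 2) := eq_neg_of_add_eq_zero_left h
  have h2 : ‖z‖ ^ 2 = Real.tan θ ^ 2 := by
    rw [← norm_pow, h1, norm_neg, norm_pow, Complex.norm_real, Real.norm_eq_abs, abs_of_pos htan0]
  have h3 : ‖z‖ = Real.tan θ := by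
    have := abs_eq_abs.2 (Or.inl rfl : ‖z‖ = ‖z‖ ∨ ‖z‖ = -‖z‖)
    nlinarith [norm_nonneg z]
  linarith

/-- **`|F₀(z)| ≤ C₅(R) λ f(0)/|z|²` for `Re z ≥ 0`, `|z| ≥ (R + 1)λ`** (Ford (7.5)–(7.6), "we obtain
`|F₀(z)| ≤ c₄ λ f(0)/|z|²`"; MTY (4.7)), from `F(z) = W(z/λ − 1)`, the closed form
`W = w(0)/z + W₀` and the bound on `W₀`: with `z' = z/λ − 1`, `|z'| ≥ R`,
`F₀(z) = W₀(z') + λ f(0)/(z(z − λ))`. [cite: Ford2002Millennium, (7.5)–(7.6)] -/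
theorem norm_fordLaplace_fordSmoothF_sub_le {R : ℝ} (hR : 3 ≤ R) (htan : Real.tan θ < R)
    (hcf : ∀ z : ℂ, z ≠ 0 → z ^ 2 + (Real.tan θ : ℂ) ^ 2 ≠ 0 →
      fordLaplaceWC θ z = (fordSmoothW0 θ : ℂ) / z + fordLaplaceW0 θ z)
    (hw0 : fordKernelW θ 0 = fordSmoothW0 θ) (hw0pos : 0 < fordSmoothW0 θ)
    {lam : ℝ} (hlam : 0 < lam) {z : ℂ} (hz : 0 ≤ z.re) (hzl : (R + 1) * lam ≤ ‖z‖) :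
    ‖fordLaplace (fordSmoothF θ lam) z - (fordSmoothF θ lam 0 : ℂ) / z‖
      ≤ fordC5 θ R * lam * fordSmoothF θ lam 0 / ‖z‖ ^ 2 := by
  have hR0 : 0 < R := by linarith
  set w0 := fordSmoothW0 θ with hw0def
  set H := fordH θ R with hHdef
  have hH0 : 0 ≤ H := fordH_nonneg_of_pos hθ hθ' hR0
  have hf0 : fordSmoothF θ lam 0 = lam * w0 := by rw [fordSmoothF_zero, hw0]
  set r := ‖z‖ with hr
  have hr0 : 0 < r := lt_of_lt_of_le (by positivity) hzl
  have hz0 : z ≠ 0 := norm_pos_iff.1 hr0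
  have hlamr : lam ≤ r / (R + 1) := by rw [le_div_iff₀ (by positivity)]; linarith
  have hlamr' : lam < r := by
    calc lam ≤ r / (R + 1) := hlamr
      _ < r := by rw [div_lt_iff₀ (by positivity)]; nlinarith
  -- `z - λ`
  have hzl1 : r * (R / (R + 1)) ≤ ‖z - lam‖ := by
    have h := norm_sub_norm_le z (lam : ℂ)
    rw [Complex.norm_real, Real.norm_eq_abs, abs_of_pos hlam, ← hr] at h
    have : r * (R / (R + 1)) = r - r / (R + 1) := by field_simp; ring
    linarith
  have hzl0 : 0 < ‖z - lam‖ := lt_of_lt_of_le (by positivity) hzl1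
  have hzlam : z - lam ≠ 0 := norm_pos_iff.1 hzl0
  -- `z' = z/λ - 1`
  set z' : ℂ := z / lam - 1 with hz'
  have hlamC : (lam : ℂ) ≠ 0 := by exact_mod_cast hlam.ne'
  have hz'eq : z' = (z - lam) / lam := by rw [hz']; field_simp
  have hz'norm : ‖z'‖ = ‖z - lam‖ / lam := by
    rw [hz'eq, norm_div, Complex.norm_real, Real.norm_eq_abs, abs_of_pos hlam]
  have hz'R : R ≤ ‖z'‖ := by
    rw [hz'norm, le_div_iff₀ hlam]
    calc R * lam ≤ R * (r / (R + 1)) := by gcongr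
      _ = r * (R / (R + 1)) := by ring
      _ ≤ ‖z - lam‖ := hzl1
  have hz're : -1 ≤ z'.re := by
    rw [hz']
    simp only [Complex.sub_re, Complex.one_re, Complex.div_ofReal_re]
    have : 0 ≤ z.re / lam := div_nonneg hz hlam.le
    linarith
  obtain ⟨hz'0, hz'1⟩ := closed_form_hyps hθ hθ' htan hz'R
  -- the decomposition `F₀(z) = W₀(z') + λ f(0)/(z (z - λ))`
  have hF : fordLaplace (fordSmoothF θ lam) z = (w0 : ℂ) / z' + fordLaplaceW0 θ z' := by
    rw [fordLaplace_fordSmoothF hlam, ← hz', hcf z' hz'0 hz'1]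
  have hdec : fordLaplace (fordSmoothF θ lam) z - (fordSmoothF θ lam 0 : ℂ) / z
      = fordLaplaceW0 θ z' + ((lam * (lam * w0) : ℝ) : ℂ) / (z * (z - lam)) := by
    rw [hF, hf0, hz'eq]
    push_cast
    field_simp
    ring
  rw [hdec]
  -- the two terms
  have hT1 : ‖fordLaplaceW0 θ z'‖ ≤ H * (R + 1) ^ 2 / (R ^ 3 * w0) * (lam * (lam * w0)) / r ^ 2 := by
    have h1 := norm_fordLaplaceW0_le hθ hθ' hR htan hz're hz'R
    have h2 : H / ‖z'‖ ^ 3 ≤ H / (r * (R / (R + 1)) / lam) ^ 3 := by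
      apply div_le_div_of_nonneg_left hH0 (by positivity)
      rw [hz'norm]
      gcongr
    have h3 : H / (r * (R / (R + 1)) / lam) ^ 3 = H * (R + 1) ^ 2 / (R ^ 3 * w0) * (lam * (lam * w0)) / r ^ 2
        * (lam * (R + 1) / r) := by
      field_simp
    have h4 : lam * (R + 1) / r ≤ 1 := by rw [div_le_one hr0]; linarith
    calc ‖fordLaplaceW0 θ z'‖ ≤ H / ‖z'‖ ^ 3 := h1
      _ ≤ H / (r * (R / (R + 1)) / lam) ^ 3 := h2
      _ = _ := h3
      _ ≤ H * (R + 1) ^ 2 / (R ^ 3 * w0) * (lam * (lam * w0)) / r ^ 2 * 1 := by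
          gcongr
      _ = _ := by rw [mul_one]
  have hT2 : ‖((lam * (lam * w0) : ℝ) : ℂ) / (z * (z - lam))‖ ≤ (1 + 1 / R) * (lam * (lam * w0)) / r ^ 2 := by
    rw [norm_div, norm_mul, Complex.norm_real, Real.norm_eq_abs, abs_of_pos (by positivity), ← hr]
    rw [div_le_div_iff₀ (by positivity) (by positivity)]
    have : (1 + 1 / R) * (r * (r * (R / (R + 1)))) = r ^ 2 := by field_simp
    calc lam * (lam * w0) * r ^ 2 = lam * (lam * w0) * ((1 + 1 / R) * (r * (r * (R / (R + 1))))) := by rw [this]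
      _ ≤ lam * (lam * w0) * ((1 + 1 / R) * (r * ‖z - ↑lam‖)) := by gcongr
      _ = (1 + 1 / R) * (lam * (lam * w0)) * (r * ‖z - ↑lam‖) := by ring
  calc ‖fordLaplaceW0 θ z' + ((lam * (lam * w0) : ℝ) : ℂ) / (z * (z - lam))‖
      ≤ ‖fordLaplaceW0 θ z'‖ + ‖((lam * (lam * w0) : ℝ) : ℂ) / (z * (z - lam))‖ := norm_add_le _ _
    _ ≤ H * (R + 1) ^ 2 / (R ^ 3 * w0) * (lam * (lam * w0)) / r ^ 2 + (1 + 1 / R) * (lam * (lam * w0)) / r ^ 2 :=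
        add_le_add hT1 hT2
    _ = fordC5 θ R * lam * fordSmoothF θ lam 0 / r ^ 2 := by
        rw [hf0, fordC5, ← hHdef, ← hw0def]
        ring

end F0bound

/-! ## `Re V_c(z) ≥ −c₅ c² w(0)` on `Re z ≥ c`, `|z| ≤ π/2` (Ford (7.6)) — proved from the kernel facts

`V_c(z) = c w(0)(cot z − 1/z) + W(z/c − 1)`; the bound holds on the segment `Re z = c` by
Lemma 4.4 and `Re W ≥ 0`, on the arc `|z| = π/2` by Lemma 4.4, the closed form and the bound on
`W₀`, and inside by the maximum principle applied to `e^{−V_c}`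
(`Complex.norm_le_of_forall_mem_frontier_norm_le`). -/

/-- `V_c(z) = c w(0)(cot z − 1/z) + W(z/c − 1)` (Ford §7). [cite: Ford2002Millennium, §7 (definition of V_c)] -/
def fordV (θ c : ℝ) (z : ℂ) : ℂ :=
  ((c * fordSmoothW0 θ : ℝ) : ℂ) * (Complex.cot z - 1 / z) + fordLaplaceWC θ (z / c - 1)

/-- `c₅ c² w(0)` with `c₅ = (4/π²)(C₅(R) − 1/R) = (4/π²)(1 + (R+1)² H(R)/(w(0) R³))` (Ford (7.6)).
[cite: Ford2002Millennium, (7.6)] -/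
def fordVBound (θ R c : ℝ) : ℝ :=
  4 / π ^ 2 * (fordC5 θ R - 1 / R) * c ^ 2 * fordSmoothW0 θ

/-- `w(0) = (θ tan θ + 3θ cot θ − 3) sec²θ > 0` for `0 < θ < π/2` (from `w(0) = ∫ g² > 0` and the
proved (4.3), `fordKernelW_zero`). [cite: MossinghoffTrudgianYangRNT2024, (4.3)] -/
theorem fordSmoothW0_pos {θ : ℝ} (hθ : 0 < θ) (hθ' : θ < π / 2) : 0 < fordSmoothW0 θ := by
  rw [← fordKernelW_zero hθ hθ']; exact fordKernelW_zero_pos hθ hθ'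

/-- The bound `c₅ c² w(0)` written out: `4c²w(0)/π² + 4 H (R+1)² c²/(π² R³)`. [folklore] -/
theorem fordVBound_eq {θ : ℝ} (hθ : 0 < θ) (hθ' : θ < π / 2) {R : ℝ} (hR : 3 ≤ R) (c : ℝ) :
    fordVBound θ R c = 4 * c ^ 2 * fordSmoothW0 θ / π ^ 2 + 4 * fordH θ R * (R + 1) ^ 2 * c ^ 2 / (π ^ 2 * R ^ 3) := by
  have hw := fordSmoothW0_pos hθ hθ'
  have hR0 : 0 < R := by linarith
  unfold fordVBound fordC5
  field_simp
  ring

section Vbound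

variable {θ : ℝ} (hθ : 0 < θ) (hθ' : θ < π / 2) {R : ℝ} (hR : 3 ≤ R) (htan : Real.tan θ < R)
  (hK : FordKernelFacts θ) {c : ℝ} (hc : 0 < c) (hcR : c ≤ π / (2 * R + 2))
include hθ hθ' hR htan hK hc hcR

omit htan hcR hK in
/-- On the segment `Re z = c`, `|z| ≤ π/2`: `Re V_c(z) ≥ −4c²w(0)/π² ≥ −c₅c²w(0)` (Lemma 4.4 and
`Re W ≥ 0`). [cite: Ford2002Millennium, §7 (proof of (7.6))] -/
theorem re_fordV_ge_of_re_eq {z : ℂ} (hzc : z.re = c) (hzn : ‖z‖ ≤ π / 2) :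
    -fordVBound θ R c ≤ (fordV θ c z).re := by
  have hw := fordSmoothW0_pos hθ hθ'
  have hR0 : 0 < R := by linarith
  have hH0 : 0 ≤ fordH θ R := fordH_nonneg_of_pos hθ hθ' hR0
  have hcot := re_cot_sub_inv_ge (z := z) (by rw [hzc]; exact hc.le) hzn
  have hW : 0 ≤ (fordLaplaceWC θ (z / c - 1)).re := by
    apply re_fordLaplaceWC_nonneg hθ hθ'
    simp only [Complex.sub_re, Complex.one_re, Complex.div_ofReal_re, hzc, div_self hc.ne']
    norm_num
  rw [fordVBound_eq hθ hθ' hR c]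
  unfold fordV
  rw [Complex.add_re, Complex.re_ofReal_mul, hzc] at *
  have h1 : -(4 * c ^ 2 * fordSmoothW0 θ / π ^ 2) ≤ c * fordSmoothW0 θ * (Complex.cot z - 1 / z).re := by
    rw [hzc] at hcot
    have := mul_le_mul_of_nonneg_left hcot (by positivity : 0 ≤ c * fordSmoothW0 θ)
    calc -(4 * c ^ 2 * fordSmoothW0 θ / π ^ 2) = c * fordSmoothW0 θ * (-(4 * c / π ^ 2)) := by ring
      _ ≤ _ := this
  have h2 : 0 ≤ 4 * fordH θ R * (R + 1) ^ 2 * c ^ 2 / (π ^ 2 * R ^ 3) := by positivity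
  linarith

/-- On the arc `|z| = π/2`, `Re z ≥ c`: `Re V_c(z) ≥ −c₅c²w(0)` (Lemma 4.4, the closed form of `W` at
`z' = z/c − 1`, `|z'| ≥ R`, and the bound on `W₀`). [cite: Ford2002Millennium, §7 (proof of (7.6))] -/
theorem re_fordV_ge_of_norm_eq {z : ℂ} (hzc : c ≤ z.re) (hzn : ‖z‖ = π / 2) :
    -fordVBound θ R c ≤ (fordV θ c z).re := by
  have hw := fordSmoothW0_pos hθ hθ'
  have hR0 : 0 < R := by linarith
  have hH0 : 0 ≤ fordH θ R := fordH_nonneg_of_pos hθ hθ' hR0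
  have hπ := Real.pi_pos
  set x := z.re with hx
  set w0 := fordSmoothW0 θ with hw0def
  set H := fordH θ R with hHdef
  -- geometry of `c`
  have hc8 : c ≤ π / 8 := hcR.trans (by rw [div_le_div_iff₀ (by positivity) (by norm_num)]; nlinarith)
  have hd0 : 0 < π / 2 - c := by linarith
  have hcc : (R + 1) * c ≤ π / 2 := by
    rw [le_div_iff₀ (by positivity)] at hcR; linarith
  -- `z - c` and `z' = z/c - 1`
  have hcC : (c : ℂ) ≠ 0 := by exact_mod_cast hc.ne'
  have hnzc : ‖z - c‖ ^ 2 = (x - c) ^ 2 + z.im ^ 2 := by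
    rw [Complex.sq_norm, Complex.normSq_apply]; simp [hx]; ring
  have hnz : x ^ 2 + z.im ^ 2 = (π / 2) ^ 2 := by
    rw [← hzn, Complex.sq_norm, Complex.normSq_apply, hx]; ring
  have hzc_le : ‖z - c‖ ^ 2 ≤ (π / 2) ^ 2 := by rw [hnzc]; nlinarith
  have hzc_ge : π / 2 - c ≤ ‖z - c‖ := by
    have h := norm_sub_norm_le z (c : ℂ)
    rw [Complex.norm_real, Real.norm_eq_abs, abs_of_pos hc, hzn] at h
    exact h
  have hzc0 : 0 < ‖z - c‖ := hd0.trans_le hzc_ge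
  have hzcne : z - c ≠ 0 := norm_pos_iff.1 hzc0
  set z' : ℂ := z / c - 1 with hz'
  have hz'eq : z' = (z - c) / c := by rw [hz']; field_simp
  have hz'norm : ‖z'‖ = ‖z - c‖ / c := by
    rw [hz'eq, norm_div, Complex.norm_real, Real.norm_eq_abs, abs_of_pos hc]
  have hz'R : R ≤ ‖z'‖ := by
    rw [hz'norm, le_div_iff₀ hc]
    linarith
  have hz're : -1 ≤ z'.re := by
    rw [hz']
    simp only [Complex.sub_re, Complex.one_re, Complex.div_ofReal_re]
    have : 0 ≤ z.re / c := div_nonneg (hc.le.trans hzc) hc.le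
    linarith
  obtain ⟨hz'0, hz'1⟩ := closed_form_hyps hθ hθ' htan hz'R
  -- the three pieces of `Re V`
  have hcot := re_cot_sub_inv_ge (z := z) (hc.le.trans hzc) hzn.le
  have hWsplit : (fordLaplaceWC θ z').re = w0 * (c * (x - c) / ‖z - c‖ ^ 2) + (fordLaplaceW0 θ z').re := by
    rw [hK.closed_form z' hz'0 hz'1, Complex.add_re, ← hw0def]
    congr 1
    have : (w0 : ℂ) / z' = (w0 * c : ℝ) * (z - c)⁻¹ := by
      rw [hz'eq]; push_cast; field_simp
    rw [this, Complex.re_ofReal_mul, Complex.inv_re, Complex.normSq_eq_norm_sq]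
    simp only [Complex.sub_re, Complex.ofReal_re, ← hx]
    field_simp
  have hW0 : -(H * c ^ 3 / (π / 2 - c) ^ 3) ≤ (fordLaplaceW0 θ z').re := by
    have h1 := norm_fordLaplaceW0_le hθ hθ' hR htan hz're hz'R
    have h2 : H / ‖z'‖ ^ 3 ≤ H * c ^ 3 / (π / 2 - c) ^ 3 := by
      rw [hz'norm, div_pow, div_div_eq_mul_div]
      apply div_le_div_of_nonneg_left (by positivity) (by positivity)
      gcongr
    have h3 := (abs_le.1 ((Complex.abs_re_le_norm _).trans (h1.trans h2))).1
    linarith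
  have hmain : -(4 * H * (R + 1) ^ 2 / (π ^ 2 * R ^ 3)) ≤ -(H * c / (π / 2 - c) ^ 3) := by
    rw [neg_le_neg_iff]
    -- `c/(π/2 - c)³ ≤ 4(R+1)²/(π²R³)` for `c ≤ π/(2R+2)`
    set d₀ : ℝ := π * R / (2 * (R + 1)) with hd₀
    have hd₀pos : 0 < d₀ := by positivity
    have hd : d₀ ≤ π / 2 - c := by
      rw [hd₀, div_le_iff₀ (by positivity)]
      nlinarith
    have hd3 : d₀ ^ 3 ≤ (π / 2 - c) ^ 3 := pow_le_pow_left₀ hd₀pos.le hd 3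
    have key : c * (π ^ 2 * R ^ 3) ≤ 4 * (R + 1) ^ 2 * d₀ ^ 3 := by
      have : 4 * (R + 1) ^ 2 * d₀ ^ 3 = π / (2 * R + 2) * (π ^ 2 * R ^ 3) := by
        rw [hd₀]; field_simp; ring
      rw [this]
      exact mul_le_mul_of_nonneg_right hcR (by positivity)
    rw [div_le_div_iff₀ (by positivity) (by positivity)]
    calc H * c * (π ^ 2 * R ^ 3) = H * (c * (π ^ 2 * R ^ 3)) := by ring
      _ ≤ H * (4 * (R + 1) ^ 2 * d₀ ^ 3) := mul_le_mul_of_nonneg_left key hH0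
      _ ≤ H * (4 * (R + 1) ^ 2 * (π / 2 - c) ^ 3) := by gcongr
      _ = 4 * H * (R + 1) ^ 2 * (π / 2 - c) ^ 3 := by ring
  -- assemble
  rw [fordVBound_eq hθ hθ' hR c]
  unfold fordV
  rw [Complex.add_re, Complex.re_ofReal_mul, ← hz', hWsplit, ← hw0def, ← hHdef]
  have h1 : c * w0 * (-(4 * x / π ^ 2)) ≤ c * w0 * (Complex.cot z - 1 / z).re :=
    mul_le_mul_of_nonneg_left hcot (by positivity)
  have h2 : c * (x - c) / (π / 2) ^ 2 ≤ c * (x - c) / ‖z - ↑c‖ ^ 2 := by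
    apply div_le_div_of_nonneg_left (by nlinarith) (by positivity) hzc_le
  have h2' := mul_le_mul_of_nonneg_left h2 hw.le
  have h3 : H * c ^ 3 / (π / 2 - c) ^ 3 = c ^ 2 * (H * c / (π / 2 - c) ^ 3) := by ring
  have h4 := mul_le_mul_of_nonneg_left hmain (sq_nonneg c)
  have e1 : c * w0 * (-(4 * x / π ^ 2)) + w0 * (c * (x - c) / (π / 2) ^ 2) = -(4 * c ^ 2 * w0 / π ^ 2) := by
    field_simp; ring
  have e2 : c ^ 2 * -(4 * H * (R + 1) ^ 2 / (π ^ 2 * R ^ 3)) = -(4 * H * (R + 1) ^ 2 * c ^ 2 / (π ^ 2 * R ^ 3)) := by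
    ring
  linarith

/-- **Ford (7.6)**: for `0 < c ≤ π/(2R + 2)`, `Re V_c(z) ≥ −c₅ c² w(0)` whenever `Re z ≥ c` and
`|z| ≤ π/2` — from the two boundary estimates by the maximum principle for `e^{−V_c}` on
`{Re z > c, |z| < π/2}`. [cite: Ford2002Millennium, (7.6)] -/
theorem re_fordV_ge {z : ℂ} (hzc : c ≤ z.re) (hzn : ‖z‖ ≤ π / 2) :
    -fordVBound θ R c ≤ (fordV θ c z).re := by
  -- boundary cases
  rcases hzc.eq_or_lt with heq | hlt
  · exact re_fordV_ge_of_re_eq hθ hθ' hR hc heq.symm hzn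
  rcases hzn.eq_or_lt with heq' | hlt'
  · exact re_fordV_ge_of_norm_eq hθ hθ' hR htan hK hc hcR hzc heq'
  -- interior: maximum principle for `exp(-V)` on `U`
  have hπ := Real.pi_pos
  set U : Set ℂ := {w : ℂ | c < w.re} ∩ Metric.ball 0 (π / 2) with hU
  have hUopen : IsOpen U := (isOpen_lt continuous_const Complex.continuous_re).inter Metric.isOpen_ball
  have hUbdd : Bornology.IsBounded U := Metric.isBounded_ball.subset Set.inter_subset_right
  have hzU : z ∈ U := ⟨hlt, by simpa using hlt'⟩
  -- closure U ⊆ K := {c ≤ re} ∩ closedBall 0 (π/2)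
  have hclos : closure U ⊆ {w : ℂ | c ≤ w.re} ∩ Metric.closedBall 0 (π / 2) := by
    refine (closure_inter_subset_inter_closure _ _).trans (Set.inter_subset_inter ?_ Metric.closure_ball_subset_closedBall)
    exact closure_lt_subset_le continuous_const Complex.continuous_re
  -- differentiability of `V` on `K`
  have hVdiff : ∀ w : ℂ, c ≤ w.re → ‖w‖ ≤ π / 2 → DifferentiableAt ℂ (fordV θ c) w := by
    intro w hw1 hw2
    have hw0 : w ≠ 0 := by
      intro h; rw [h, Complex.zero_re] at hw1; linarith
    have hsin : Complex.sin w ≠ 0 := by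
      intro h
      obtain ⟨k, hk⟩ := Complex.sin_eq_zero_iff.1 h
      have hk0 : k ≠ 0 := by
        rintro rfl; simp at hk; exact hw0 hk
      have h1 : (1 : ℝ) ≤ |(k : ℝ)| := by exact_mod_cast Int.one_le_abs hk0
      have h2 : ‖w‖ = |(k : ℝ)| * π := by
        rw [hk, norm_mul, Complex.norm_intCast, Complex.norm_real, Real.norm_eq_abs, abs_of_pos hπ]
      nlinarith
    have hcot : DifferentiableAt ℂ Complex.cot w := by
      have : Complex.cot = fun w ↦ Complex.cos w / Complex.sin w := by funext w; rfl
      rw [this]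
      exact Complex.differentiable_cos.differentiableAt.div Complex.differentiable_sin.differentiableAt hsin
    unfold fordV
    refine ((hcot.sub ((differentiableAt_const _).div differentiableAt_id hw0)).const_mul _).add ?_
    exact ((differentiable_fordLaplaceWC hθ hθ').differentiableAt).comp w ((differentiableAt_id.div_const _).sub_const _)
  have hd : DiffContOnCl ℂ (fun w ↦ Complex.exp (-fordV θ c w)) U := by
    apply DifferentiableOn.diffContOnCl
    intro w hw
    obtain ⟨hw1, hw2⟩ := hclos hw
    exact ((hVdiff w hw1 (by simpa using hw2)).neg.cexp).differentiableWithinAt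
  -- the bound on the frontier
  have hfront : ∀ w ∈ frontier U, ‖Complex.exp (-fordV θ c w)‖ ≤ Real.exp (fordVBound θ R c) := by
    intro w hw
    rw [hUopen.frontier_eq] at hw
    obtain ⟨hw1, hw2⟩ := hw
    obtain ⟨hw3, hw4⟩ := hclos hw1
    have hw4' : ‖w‖ ≤ π / 2 := by simpa using hw4
    have hbd : -fordVBound θ R c ≤ (fordV θ c w).re := by
      by_cases h1 : w.re = c
      · exact re_fordV_ge_of_re_eq hθ hθ' hR hc h1 hw4'
      · have h2 : ‖w‖ = π / 2 := by
          by_contra h2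
          exact hw2 ⟨lt_of_le_of_ne hw3 (Ne.symm h1), by simpa using lt_of_le_of_ne hw4' h2⟩
        exact re_fordV_ge_of_norm_eq hθ hθ' hR htan hK hc hcR hw3 h2
    rw [Complex.norm_exp, Real.exp_le_exp, Complex.neg_re]
    linarith
  have key := Complex.norm_le_of_forall_mem_frontier_norm_le hUbdd hd hfront (subset_closure hzU)
  rw [Complex.norm_exp, Real.exp_le_exp, Complex.neg_re] at key
  linarith

end Vbound

/-! ## The smoothed zero-detector inequality and its inputs, as predicates (Ford Lemmas 4.6, 5.1, 4.3 = MTY Lemmas 4.2–4.4, 4.6)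

The three analytic lemmas that the proof of Lemma 4.7 combines are recorded here only through
the SHAPE of their conclusions (predicates with all data explicit); the assembly theorem below
takes the lemmas themselves as hypotheses (universally quantified implications between these
predicates), so that no unproved named fact is introduced in this file. -/

/-- `∫_{−∞}^{∞} log|ζ(σ + i(τ + κu))| / cosh²u du` — the weighted integrals of `log|ζ|` on vertical
lines in Ford's zero detector (Ford Lemma 2.2, 3.4, 4.6, 5.1 with `κ = 2η/π`; MTY Lemmas 4.1–4.4).
[cite: Ford2002Millennium, Lemma 4.6] -/
def fordLogZetaIntegral (σ τ κ : ℝ) : ℝ :=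
  ∫ u : ℝ, Real.log ‖riemannZeta ((σ : ℂ) + ((τ + u * κ : ℝ) : ℂ) * I)‖ / Real.cosh u ^ 2

/-- The sum over the zeros near `1 + it` in Ford's Lemma 4.6 / MTY Lemma 4.2:
`Σ_{|1+it−ρ| ≤ η} m(ρ) Re{F(1 + it − ρ) + f(0)((π/2η) cot((π/2η)(1 + it − ρ)) − 1/(1 + it − ρ))}`.
[cite: Ford2002Millennium, Lemma 4.6] -/
def fordNearSum (f : ℝ → ℝ) (η t : ℝ) : ℝ :=
  ∑ ρ ∈ fordNearZeros t η, (riemannZetaZeroOrder ρ : ℝ) *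
    (fordLaplace f (1 + t * I - ρ)
      + (f 0 : ℂ) * (((π / (2 * η) : ℝ) : ℂ) * Complex.cot (((π / (2 * η) : ℝ) : ℂ) * (1 + t * I - ρ))
          - 1 / (1 + t * I - ρ))).re

/-- An admissible smoothing function for Ford's Lemmas 4.5–4.6 (MTY Lemma 4.2) with `F₀`-constant
`D` from the threshold `η` on: `f ∈ C¹(ℝ)`, `f ≥ 0`, `f` vanishes on some `[x₀, ∞)`, and
`|F(z) − f(0)/z| ≤ D/|z|²` for `Re z ≥ 0`, `|z| ≥ η` (Ford (4.5)). [cite: Ford2002Millennium, Lemma 4.5 and (4.5)] -/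
structure IsFordSmoothing (f : ℝ → ℝ) (η D : ℝ) : Prop where
  /-- `f` is continuously differentiable. [cite: Ford2002Millennium, Lemma 4.5] -/
  contDiff : ContDiff ℝ 1 f
  /-- `f ≥ 0`. [cite: Ford2002Millennium, Lemma 4.5] -/
  nonneg : ∀ u, 0 ≤ f u
  /-- `f` has compact support in `[0, ∞)`: it vanishes on some `[x₀, ∞)`. [cite: Ford2002Millennium, Lemma 4.6] -/
  eventually_zero : ∃ x₀ : ℝ, ∀ u, x₀ ≤ u → f u = 0
  /-- Ford's (4.5): `|F₀(z)| ≤ D/|z|²` for `Re z ≥ 0`, `|z| ≥ η`. [cite: Ford2002Millennium, (4.5)] -/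
  laplace_bound : ∀ z : ℂ, 0 ≤ z.re → η ≤ ‖z‖ → ‖fordLaplace f z - (f 0 : ℂ) / z‖ ≤ D / ‖z‖ ^ 2

/-- The conclusion of the smoothed zero detector (Ford 2002, **Lemma 4.6**, first display =
Mossinghoff–Trudgian–Yang **Lemma 4.2**, (4.8), with the integral on `Re s = 1 − η` already bounded
by MTY Lemma 4.3 and (3.1)) at the data `(A, B, η, f, D, t, S)`:
`Re K(1+it) ≤ −(near-zero sum) + (f(0)/2η)[(2/3) log log t + Bη^{3/2} log t + log A`
`− (1/2)∫ log|ζ(1+η+i(t+2ηu/π))|/cosh²u du] + D(1.8 + (log t)/3 + S)`, where `S` bounds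
`Σ_{|1+it−ρ| ≥ η} |1+it−ρ|^{-2}`. [cite: Ford2002Millennium, Lemma 4.6]
[cite: MossinghoffTrudgianYangRNT2024, Lemma 4.2 and Lemma 4.3] -/
def FordDetectorIneq (A B η : ℝ) (f : ℝ → ℝ) (D t S : ℝ) : Prop :=
  (fordK f (1 + t * I)).re ≤
    -fordNearSum f η t
    + f 0 / (2 * η) * (2 / 3 * Real.log (Real.log t) + B * η ^ (3 / 2 : ℝ) * Real.log t + Real.log A
        - 1 / 2 * fordLogZetaIntegral (1 + η) t (2 * η / π))
    + D * (1.8 + Real.log t / 3 + S)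

/-- The right-hand side of Mossinghoff–Trudgian–Yang **Lemma 4.6** (far-zero sum):
`[5.409 + 5.392B(η^{-1/2} − 2)] log t + 206.7 + η^{-2}{(log A − log η + (2/3) log log t)/1.879 + 0.213 − N(t, η)}`.
[cite: MossinghoffTrudgianYangRNT2024, Lemma 4.6] -/
def mtyFarZeroBound (A B t η : ℝ) : ℝ :=
  (5.409 + 5.392 * B * (1 / Real.sqrt η - 2)) * Real.log t + 206.7
    + 1 / η ^ 2 * ((Real.log A - Real.log η + 2 / 3 * Real.log (Real.log t)) / 1.879 + 0.213 - fordN t η)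

/-- `mtyFarZeroBound` with the constant `0.213` of MTY Lemma 4.6 — which is `0.479 − 1/(2·1.879)`
rounded up, `0.479` being the constant of MTY Lemma 4.5 (Ford's Lemma 4.2: `0.49`) — replaced by
a parameter `c46`, so that the assembly below can be fed any proved version of Lemma 4.5/4.6.
[cite: MossinghoffTrudgianYangRNT2024, Lemma 4.6] -/
def mtyFarZeroBoundWith (c46 A B t η : ℝ) : ℝ :=
  (5.409 + 5.392 * B * (1 / Real.sqrt η - 2)) * Real.log t + 206.7
    + 1 / η ^ 2 * ((Real.log A - Real.log η + 2 / 3 * Real.log (Real.log t)) / 1.879 + c46 - fordN t η)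

/-- `mtyFarZeroBound = mtyFarZeroBoundWith 0.213`. [cite: MossinghoffTrudgianYangRNT2024, Lemma 4.6] -/
theorem mtyFarZeroBound_eq_with (A B t η : ℝ) :
    mtyFarZeroBound A B t η = mtyFarZeroBoundWith 0.213 A B t η := rfl

/-- The far-zero bound of MTY Lemma 4.6 with all three of its numerical constants as parameters:
`(C₁ + 5.392B(η^{-1/2} − 2)) log t + C₃ + η^{-2}{(log A − log η + (2/3) log log t)/1.879 + c46 − N(t, η)}`
(`C₁ = 5.409`, `C₃ = 206.7` in print, from (3.8); `5.392 = 4 · 1.3478` is the Lemma-4.5 slope and is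
kept). For assemblies fed by other zero-counting bounds than (3.8). [cite: MossinghoffTrudgianYangRNT2024, Lemma 4.6] -/
def mtyFarZeroBoundGen (C₁ C₃ c46 A B t η : ℝ) : ℝ :=
  (C₁ + 5.392 * B * (1 / Real.sqrt η - 2)) * Real.log t + C₃
    + 1 / η ^ 2 * ((Real.log A - Real.log η + 2 / 3 * Real.log (Real.log t)) / 1.879 + c46 - fordN t η)

/-- `mtyFarZeroBoundWith c46 = mtyFarZeroBoundGen 5.409 206.7 c46`. [cite: MossinghoffTrudgianYangRNT2024, Lemma 4.6] -/
theorem mtyFarZeroBoundWith_eq_gen (c46 A B t η : ℝ) :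
    mtyFarZeroBoundWith c46 A B t η = mtyFarZeroBoundGen 5.409 206.7 c46 A B t η := rfl

/-! ## Positivity of the mollified sum: Ford (6.1) -/

/-- `Re K(1 + iτ)` as a finite sum: `Σ_n Λ(n) f(log n) n^{-1} cos(τ log n)` when `f` vanishes on
`[x₀, ∞)`. [cite: Ford2002Millennium, (6.1)] -/
theorem re_fordK_one_add {f : ℝ → ℝ} {x₀ : ℝ} (hf : ∀ u, x₀ ≤ u → f u = 0) (τ : ℝ) :
    (fordK f (1 + τ * I)).re =
      ∑ n ∈ Finset.range ⌈Real.exp x₀⌉₊,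
        ArithmeticFunction.vonMangoldt n * f (Real.log n) * ((n : ℝ)⁻¹ * Real.cos (τ * Real.log n)) := by
  have hN : 1 ≤ ⌈Real.exp x₀⌉₊ := Nat.one_le_iff_ne_zero.2 (Nat.ceil_pos.2 (Real.exp_pos _)).ne'
  have hx : x₀ ≤ Real.log (⌈Real.exp x₀⌉₊ : ℕ) := by
    have h1 : Real.exp x₀ ≤ (⌈Real.exp x₀⌉₊ : ℕ) := Nat.le_ceil _
    calc x₀ = Real.log (Real.exp x₀) := (Real.log_exp x₀).symm
      _ ≤ _ := Real.log_le_log (Real.exp_pos _) h1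
  rw [fordK_eq_sum hf hN hx, Complex.re_sum]
  refine Finset.sum_congr rfl fun n _ ↦ ?_
  rcases Nat.eq_zero_or_pos n with rfl | hn
  · simp
  have hnC : (n : ℂ) ≠ 0 := by exact_mod_cast hn.ne'
  have hnR : (0 : ℝ) < n := by exact_mod_cast hn
  rw [Complex.cpow_def_of_ne_zero hnC, ← Complex.natCast_log,
    show ((ArithmeticFunction.vonMangoldt n : ℝ) : ℂ) * (f (Real.log n) : ℂ)
      = ((ArithmeticFunction.vonMangoldt n * f (Real.log n) : ℝ) : ℂ) by push_cast; ring,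
    Complex.re_ofReal_mul, Complex.exp_re]
  congr 1
  have hre : ((Real.log n : ℂ) * -(1 + τ * I)).re = -Real.log n := by
    simp only [Complex.mul_re, Complex.neg_re, Complex.neg_im, Complex.add_re, Complex.add_im,
      Complex.one_re, Complex.one_im, Complex.ofReal_re, Complex.ofReal_im, Complex.mul_im,
      Complex.I_re, Complex.I_im]
    ring
  have him : ((Real.log n : ℂ) * -(1 + τ * I)).im = -(τ * Real.log n) := by
    simp only [Complex.mul_re, Complex.neg_re, Complex.neg_im, Complex.add_re, Complex.add_im,
      Complex.one_re, Complex.one_im, Complex.ofReal_re, Complex.ofReal_im, Complex.mul_im,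
      Complex.I_re, Complex.I_im]
    ring
  rw [hre, him, Real.cos_neg, Real.exp_neg, Real.exp_log hnR]

/-- **Ford (6.1)**: for a non-negative trigonometric polynomial `Σ_{j ≤ K} b_j cos(jx) ≥ 0` and
`f ≥ 0` of compact support, `Σ_{j=0}^{K} b_j Re K(1 + ijt) = Σ_n Λ(n) n^{-1} f(log n) Σ_j b_j cos(jt log n) ≥ 0`.
[cite: Ford2002Millennium, (6.1)] -/
theorem fordK_trigPoly_nonneg {f : ℝ → ℝ} {x₀ : ℝ} (hf0 : ∀ u, 0 ≤ f u)
    (hf : ∀ u, x₀ ≤ u → f u = 0) {K : ℕ} {b : ℕ → ℝ} (hb : IsNonnegTrigPoly K b) (t : ℝ) :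
    0 ≤ ∑ j ∈ Finset.range (K + 1), b j * (fordK f (1 + ((j : ℝ) * t : ℝ) * I)).re := by
  simp_rw [re_fordK_one_add hf, Finset.mul_sum]
  rw [Finset.sum_comm]
  refine Finset.sum_nonneg fun n _ ↦ ?_
  have e : ∑ j ∈ Finset.range (K + 1), b j * (ArithmeticFunction.vonMangoldt n * f (Real.log n)
      * ((n : ℝ)⁻¹ * Real.cos ((j : ℝ) * t * Real.log n)))
      = ArithmeticFunction.vonMangoldt n * f (Real.log n) * (n : ℝ)⁻¹ * trigPoly K b (t * Real.log n) := by
    rw [trigPoly, Finset.mul_sum]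
    refine Finset.sum_congr rfl fun j _ ↦ ?_
    rw [show (j : ℝ) * t * Real.log n = j * (t * Real.log n) by ring]
    ring
  rw [e]
  exact mul_nonneg (mul_nonneg (mul_nonneg ArithmeticFunction.vonMangoldt_nonneg (hf0 _))
    (inv_nonneg.2 n.cast_nonneg)) (hb.2.2 _)

/-- Ford (6.1) with the `j = 0` term separated: `0 ≤ b₀ Re K(1) + Σ_{j=1}^{K} b_j Re K(1 + ijt)`.
[cite: Ford2002Millennium, (6.1)] -/
theorem fordK_trigPoly_nonneg' {f : ℝ → ℝ} {x₀ : ℝ} (hf0 : ∀ u, 0 ≤ f u)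
    (hf : ∀ u, x₀ ≤ u → f u = 0) {K : ℕ} {b : ℕ → ℝ} (hb : IsNonnegTrigPoly K b) (t : ℝ) :
    0 ≤ b 0 * (fordK f 1).re
      + ∑ j ∈ Finset.range K, b (j + 1) * (fordK f (1 + ((((j : ℝ) + 1) * t : ℝ) : ℂ) * I)).re := by
  have h := fordK_trigPoly_nonneg hf0 hf hb t
  rw [Finset.sum_range_succ'] at h
  have e0 : (1 : ℂ) + ((((0 : ℕ) : ℝ) * t : ℝ) : ℂ) * I = 1 := by simp
  have e1 : ∀ j : ℕ, (1 : ℂ) + ((((j + 1 : ℕ) : ℝ) * t : ℝ) : ℂ) * I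
      = 1 + ((((j : ℝ) + 1) * t : ℝ) : ℂ) * I := by
    intro j; push_cast; ring
  rw [e0] at h
  simp_rw [e1] at h
  linarith

/-! ## The near-zero sums for Ford's smoothing function: reduction to `V_c` (Ford §7) -/

section nearsum

variable {θ : ℝ} (hθ : 0 < θ) (hθ' : θ < π / 2)
include hθ hθ'

omit hθ hθ' in
/-- For `f(u) = λe^{λu}w(λu)`: `F(s − ρ) + f(0)(κ cot(κ(s − ρ)) − 1/(s − ρ)) = V_c(κ(s − ρ))` with
`κ = π/(2η)`, `c = κλ` (Ford §7: "`F(1+ijt−ρ) + f(0)(…) = V_c(z)` where `z = (π/2η)(1+ijt−ρ)`,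
`c = πλ/(2η)`"). [cite: Ford2002Millennium, §7 (after (7.6))] -/
theorem fordNearSum_summand_eq {lam η : ℝ} (hlam : 0 < lam) (hη : 0 < η)
    (hw0 : fordKernelW θ 0 = fordSmoothW0 θ) {s ρ : ℂ} (hsρ : s - ρ ≠ 0) :
    fordLaplace (fordSmoothF θ lam) (s - ρ)
      + (fordSmoothF θ lam 0 : ℂ) *
        (((π / (2 * η) : ℝ) : ℂ) * Complex.cot (((π / (2 * η) : ℝ) : ℂ) * (s - ρ)) - 1 / (s - ρ))
    = fordV θ (π / (2 * η) * lam) (((π / (2 * η) : ℝ) : ℂ) * (s - ρ)) := by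
  have hκ : (0 : ℝ) < π / (2 * η) := by positivity
  set κ : ℝ := π / (2 * η) with hκdef
  have hκC : (κ : ℂ) ≠ 0 := by exact_mod_cast hκ.ne'
  have hlC : (lam : ℂ) ≠ 0 := by exact_mod_cast hlam.ne'
  unfold fordV
  rw [fordLaplace_fordSmoothF hlam, fordSmoothF_zero, hw0]
  have harg : ((κ : ℂ) * (s - ρ)) / (((κ * lam : ℝ)) : ℂ) - 1 = (s - ρ) / (lam : ℂ) - 1 := by
    push_cast
    field_simp
  rw [harg, add_comm]
  congr 1
  set Z : ℂ := Complex.cot ((κ : ℂ) * (s - ρ)) with hZ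
  push_cast
  field_simp

omit hθ hθ' in
/-- A zero `ρ` of `ζ` is not on the line `Re s = 1`: `1 + iτ − ρ ≠ 0`. [folklore] -/
theorem one_add_mul_I_sub_ne_zero {ρ : ℂ} (hρ : riemannZeta ρ = 0) (τ : ℝ) : 1 + τ * I - ρ ≠ 0 := by
  intro h
  have : ρ = 1 + τ * I := (sub_eq_zero.1 h).symm
  exact riemannZeta_ne_zero_of_one_le_re (s := ρ) (by simp [this]) hρ

omit hθ hθ' in
/-- The near-zero sum for Ford's `f` is `Σ_ρ m(ρ) Re V_c(κ(1 + iτ − ρ))`. [cite: Ford2002Millennium, §7] -/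
theorem fordNearSum_fordSmoothF_eq {lam η : ℝ} (hlam : 0 < lam) (hη : 0 < η)
    (hw0 : fordKernelW θ 0 = fordSmoothW0 θ) (τ : ℝ) :
    fordNearSum (fordSmoothF θ lam) η τ =
      ∑ ρ ∈ fordNearZeros τ η, (riemannZetaZeroOrder ρ : ℝ) *
        (fordV θ (π / (2 * η) * lam) (((π / (2 * η) : ℝ) : ℂ) * (1 + τ * I - ρ))).re := by
  unfold fordNearSum
  refine Finset.sum_congr rfl fun ρ hρ ↦ ?_
  rw [mem_fordNearZeros] at hρ
  rw [fordNearSum_summand_eq hlam hη hw0 (one_add_mul_I_sub_ne_zero hρ.1 τ)]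

omit hθ hθ' in
/-- `c = πλ/(2η)` satisfies `c ≤ π/(2R + 2)` when `λ ≤ η/(R + 1)` (`R ≥ 3`, `η > 0`).
[cite: Ford2002Millennium, §7] -/
theorem fordC_le {R lam η : ℝ} (hR : 3 ≤ R) (hη : 0 < η) (hlamR : lam ≤ η / (R + 1)) :
    π / (2 * η) * lam ≤ π / (2 * R + 2) := by
  have hR0 : 0 < R + 1 := by linarith
  rw [le_div_iff₀ hR0] at hlamR
  rw [div_mul_eq_mul_div, div_le_div_iff₀ (by positivity) (by positivity)]
  nlinarith [Real.pi_pos]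

/-- `c₅ c² w(0) ≥ 0`. [folklore] -/
theorem fordVBound_nonneg {R : ℝ} (hR : 3 ≤ R) (c : ℝ) : 0 ≤ fordVBound θ R c := by
  rw [fordVBound_eq hθ hθ' hR c]
  have := fordSmoothW0_pos hθ hθ'
  have := fordH_nonneg_of_pos hθ hθ' (by linarith : 0 < R)
  positivity

variable {R : ℝ} (hR : 3 ≤ R) (htan : Real.tan θ < R) (hK : FordKernelFacts θ)
  {lam η : ℝ} (hlam : 0 < lam) (hη : 0 < η) (hlamR : lam ≤ η / (R + 1))
include hR htan hK hlam hη hlamR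

/-- **The near-zero sum at height `τ`, all of whose zeros `ρ` near `1 + iτ` have `Re ρ ≤ 1 − λ`:**
`−(near sum) ≤ c₅ c² w(0) · N(τ, η)` (each term is `−m(ρ) Re V_c(z_ρ)` with `Re z_ρ ≥ c`,
`|z_ρ| ≤ π/2`, so (7.6) applies). [cite: Ford2002Millennium, §7 (display before (7.7))] -/
theorem neg_fordNearSum_le {τ : ℝ} (hzeros : ∀ ρ ∈ fordNearZeros τ η, ρ.re ≤ 1 - lam) :
    -fordNearSum (fordSmoothF θ lam) η τ ≤ fordVBound θ R (π / (2 * η) * lam) * fordN τ η := by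
  have hc : 0 < π / (2 * η) * lam := by positivity
  have hcR := fordC_le hR hη hlamR
  rw [fordNearSum_fordSmoothF_eq hlam hη (fordKernelW_zero hθ hθ'), fordN, Finset.mul_sum, ← Finset.sum_neg_distrib]
  refine Finset.sum_le_sum fun ρ hρ ↦ ?_
  have hre := hzeros ρ hρ
  rw [mem_fordNearZeros] at hρ
  have hm : (0 : ℝ) ≤ riemannZetaZeroOrder ρ := by
    exact_mod_cast riemannZetaZeroOrder_nonneg fun h1 ↦ riemannZeta_one_ne_zero (h1 ▸ hρ.1)
  have hV := re_fordV_ge hθ hθ' hR htan hK hc hcR (z := ((π / (2 * η) : ℝ) : ℂ) * (1 + τ * I - ρ)) ?_ ?_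
  · rw [mul_comm (fordVBound θ R _)]
    nlinarith
  · have hre_eq : (((π / (2 * η) : ℝ) : ℂ) * (1 + τ * I - ρ)).re = π / (2 * η) * (1 - ρ.re) := by
      rw [Complex.re_ofReal_mul]; simp
    rw [hre_eq]
    exact mul_le_mul_of_nonneg_left (by linarith) (by positivity)
  · rw [norm_mul, Complex.norm_real, Real.norm_eq_abs, abs_of_pos (by positivity : (0:ℝ) < π / (2 * η))]
    calc π / (2 * η) * ‖1 + τ * I - ρ‖ ≤ π / (2 * η) * η := by gcongr; exact hρ.2
      _ = π / 2 := by field_simp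

/-- **The near-zero sum at the height `t` of the zero `β + it` itself** (`|1 + it − ρ₀| = 1 − β ≤ η`):
the term of `ρ₀` is kept, `−(near sum) ≤ −Re V_c(κ(1 − β)) + c₅ c² w(0) N(t, η)` (using
`m(ρ₀) ≥ 1` and (7.6) for the other `m(ρ₀) − 1 + Σ_{ρ ≠ ρ₀} m(ρ)` terms).
[cite: Ford2002Millennium, §7 (display before (7.7))] -/
theorem neg_fordNearSum_le_of_zero {β t : ℝ} (hzero : riemannZeta (β + t * I) = 0) (hβη : 1 - β ≤ η)
    (hzeros : ∀ ρ ∈ fordNearZeros t η, ρ.re ≤ 1 - lam) :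
    -fordNearSum (fordSmoothF θ lam) η t ≤
      -(fordV θ (π / (2 * η) * lam) (((π / (2 * η) * (1 - β) : ℝ) : ℂ))).re
        + fordVBound θ R (π / (2 * η) * lam) * fordN t η := by
  have hc : 0 < π / (2 * η) * lam := by positivity
  have hcR := fordC_le hR hη hlamR
  set ρ₀ : ℂ := β + t * I with hρ₀
  have hβ1 : 0 < 1 - β := one_sub_pos_of_riemannZeta_eq_zero hzero
  have hdiff : (1 : ℂ) + t * I - ρ₀ = ((1 - β : ℝ) : ℂ) := by rw [hρ₀]; push_cast; ring
  have hmem : ρ₀ ∈ fordNearZeros t η := by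
    rw [mem_fordNearZeros, hdiff, Complex.norm_real, Real.norm_eq_abs, abs_of_pos hβ1]
    exact ⟨hzero, hβη⟩
  set bd := fordVBound θ R (π / (2 * η) * lam) with hbd
  have hbd0 : 0 ≤ bd := fordVBound_nonneg hθ hθ' hR _
  set V : ℂ → ℝ := fun ρ ↦ (fordV θ (π / (2 * η) * lam) (((π / (2 * η) : ℝ) : ℂ) * (1 + t * I - ρ))).re with hVdef
  -- (7.6) at every near zero
  have hVge : ∀ ρ ∈ fordNearZeros t η, -bd ≤ V ρ := by
    intro ρ hρ
    have hre := hzeros ρ hρ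
    rw [mem_fordNearZeros] at hρ
    refine re_fordV_ge hθ hθ' hR htan hK hc hcR ?_ ?_
    · have hre_eq : (((π / (2 * η) : ℝ) : ℂ) * (1 + t * I - ρ)).re = π / (2 * η) * (1 - ρ.re) := by
        rw [Complex.re_ofReal_mul]; simp
      rw [hre_eq]
      exact mul_le_mul_of_nonneg_left (by linarith) (by positivity)
    · rw [norm_mul, Complex.norm_real, Real.norm_eq_abs, abs_of_pos (by positivity : (0:ℝ) < π / (2 * η))]
      calc π / (2 * η) * ‖1 + t * I - ρ‖ ≤ π / (2 * η) * η := by gcongr; exact hρ.2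
        _ = π / 2 := by field_simp
  have hm : ∀ ρ ∈ fordNearZeros t η, (1 : ℝ) ≤ riemannZetaZeroOrder ρ := by
    intro ρ hρ
    rw [mem_fordNearZeros] at hρ
    have h1 : ρ ≠ 1 := fun h1 ↦ riemannZeta_one_ne_zero (h1 ▸ hρ.1)
    exact_mod_cast (riemannZetaZeroOrder_pos_iff h1).2 hρ.1
  -- split off `ρ₀`
  rw [fordNearSum_fordSmoothF_eq hlam hη (fordKernelW_zero hθ hθ'), fordN,
    ← Finset.add_sum_erase _ _ hmem, ← Finset.add_sum_erase _ _ hmem]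
  have hV0 : V ρ₀ = (fordV θ (π / (2 * η) * lam) (((π / (2 * η) * (1 - β) : ℝ) : ℂ))).re := by
    simp only [hVdef, hdiff]; push_cast; ring_nf
  have hrest : -(∑ ρ ∈ (fordNearZeros t η).erase ρ₀, (riemannZetaZeroOrder ρ : ℝ) * V ρ)
      ≤ bd * ∑ ρ ∈ (fordNearZeros t η).erase ρ₀, (riemannZetaZeroOrder ρ : ℝ) := by
    rw [Finset.mul_sum, ← Finset.sum_neg_distrib]
    refine Finset.sum_le_sum fun ρ hρ ↦ ?_
    have hρ' := Finset.mem_of_mem_erase hρ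
    have h1 := hVge ρ hρ'
    have h2 := hm ρ hρ'
    nlinarith
  have h0 := hVge ρ₀ hmem
  have hm0 := hm ρ₀ hmem
  change -((riemannZetaZeroOrder ρ₀ : ℝ) * V ρ₀ + ∑ ρ ∈ (fordNearZeros t η).erase ρ₀, (riemannZetaZeroOrder ρ : ℝ) * V ρ)
    ≤ -(fordV θ (π / (2 * η) * lam) (((π / (2 * η) * (1 - β) : ℝ) : ℂ))).re
      + bd * ((riemannZetaZeroOrder ρ₀ : ℝ) + ∑ ρ ∈ (fordNearZeros t η).erase ρ₀, (riemannZetaZeroOrder ρ : ℝ))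
  rw [← hV0]
  nlinarith [mul_nonneg (sub_nonneg.2 hm0) (add_nonneg hbd0 (le_refl 0)), mul_le_mul_of_nonneg_left h0 (sub_nonneg.2 hm0)]

end nearsum

/-! ## The assembly: Lemma 4.7 from Ford's Lemma 4.6 (MTY 4.2–4.3), MTY Lemma 4.4, MTY Lemma 4.6 and the kernel facts -/

/-! ### Elementary bookkeeping for the assembly -/

/-- For `t ≥ 10⁴` and `1 ≤ j + 1 ≤ 40`: `0 < log((j+1)t) ≤ L₁ = log(40t + 1)` and
`log log((j+1)t) ≤ L₂ = log log(40t + 1)`. [folklore] -/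
theorem mty_logs_le {t : ℝ} (ht : 10000 ≤ t) {j : ℕ} (hj : j < 40) :
    0 < Real.log (((j : ℝ) + 1) * t) ∧ Real.log (((j : ℝ) + 1) * t) ≤ Real.log (40 * t + 1) ∧
      Real.log (Real.log (((j : ℝ) + 1) * t)) ≤ Real.log (Real.log (40 * t + 1)) := by
  have hj' : (j : ℝ) + 1 ≤ 40 := by
    have : (j : ℝ) ≤ 39 := by exact_mod_cast Nat.lt_succ_iff.1 hj
    linarith
  have hj0 : (0 : ℝ) ≤ j := j.cast_nonneg
  have hτ1 : 1 < ((j : ℝ) + 1) * t := by nlinarith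
  have hτ2 : ((j : ℝ) + 1) * t ≤ 40 * t + 1 := by nlinarith
  have h1 : 0 < Real.log (((j : ℝ) + 1) * t) := Real.log_pos hτ1
  have h2 : Real.log (((j : ℝ) + 1) * t) ≤ Real.log (40 * t + 1) :=
    Real.log_le_log (by linarith) hτ2
  exact ⟨h1, h2, Real.log_le_log h1 h2⟩

/-- `η ≤ 1/4` gives `1/√η ≥ 2`, so the coefficient `5.409 + 5.392B(η^{-1/2} − 2)` of MTY Lemma 4.6
is `≥ 0` for `B ≥ 0`. [folklore] -/
theorem two_le_one_div_sqrt {η : ℝ} (hη : 0 < η) (hη4 : η ≤ 1 / 4) : 2 ≤ 1 / Real.sqrt η := by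
  have h1 : Real.sqrt η ≤ 1 / 2 := by
    rw [show (1 / 2 : ℝ) = Real.sqrt (1 / 4) by
      rw [show (1 / 4 : ℝ) = (1 / 2) ^ 2 by norm_num, Real.sqrt_sq (by norm_num)]]
    exact Real.sqrt_le_sqrt hη4
  have h2 : 0 < Real.sqrt η := Real.sqrt_pos.2 hη
  rw [le_div_iff₀ h2]
  linarith

/-- One step of the summation over `j` in the proof of Lemma 4.7: from the detector inequality at
height `(j+1)t` (with the far-zero sum bounded by MTY Lemma 4.6), replace `log((j+1)t)`,
`log log((j+1)t)` by `L₁`, `L₂` and multiply by `b_{j+1} ≥ 0`. [cite: Ford2002Millennium, (6.2)] -/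
theorem detector_step {K NS Iv N Lg LL L₁ L₂ f0 η B logA logη D b c46 C₁ C₃ : ℝ}
    (hC₁ : 0 ≤ C₁) (hη : 0 < η) (hη4 : η ≤ 1 / 4) (hf0 : 0 ≤ f0) (hD : 0 ≤ D) (hB : 0 ≤ B) (hb : 0 ≤ b)
    (hLg : Lg ≤ L₁) (hLL : LL ≤ L₂)
    (h : K ≤ -NS + f0 / (2 * η) * (2 / 3 * LL + B * η ^ (3 / 2 : ℝ) * Lg + logA - 1 / 2 * Iv)
        + D * (1.8 + Lg / 3 + ((C₁ + 5.392 * B * (1 / Real.sqrt η - 2)) * Lg + C₃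
          + 1 / η ^ 2 * ((logA - logη + 2 / 3 * LL) / 1.879 + c46 - N)))) :
    b * K ≤ b * (f0 / (2 * η) * (2 / 3 * L₂ + B * η ^ (3 / 2 : ℝ) * L₁ + logA)
        + D * (1.8 + L₁ / 3 + (C₁ + 5.392 * B * (1 / Real.sqrt η - 2)) * L₁ + C₃
          + 1 / η ^ 2 * ((logA - logη + 2 / 3 * L₂) / 1.879 + c46)))
      - b * NS - f0 / (4 * η) * (b * Iv) - D / η ^ 2 * (b * N) := by
  have hsq := two_le_one_div_sqrt hη hη4
  have hC : 0 ≤ C₁ + 5.392 * B * (1 / Real.sqrt η - 2) := by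
    have : 0 ≤ 5.392 * B * (1 / Real.sqrt η - 2) := by
      apply mul_nonneg (by positivity); linarith
    linarith
  have hη32 : 0 ≤ η ^ (3 / 2 : ℝ) := by positivity
  have hcoef1 : 0 ≤ f0 / (2 * η) * B * η ^ (3 / 2 : ℝ) + D / 3 + D * (C₁ + 5.392 * B * (1 / Real.sqrt η - 2)) := by
    have h1 : 0 ≤ f0 / (2 * η) * B * η ^ (3 / 2 : ℝ) := by positivity
    have h2 := mul_nonneg hD hC
    linarith
  have hcoef2 : 0 ≤ f0 / (2 * η) * (2 / 3) + D * (1 / η ^ 2) * (2 / 3 / 1.879) := by positivity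
  have h3 : K ≤ -NS + f0 / (2 * η) * (2 / 3 * L₂ + B * η ^ (3 / 2 : ℝ) * L₁ + logA) - f0 / (4 * η) * Iv
      + D * (1.8 + L₁ / 3 + (C₁ + 5.392 * B * (1 / Real.sqrt η - 2)) * L₁ + C₃
        + 1 / η ^ 2 * ((logA - logη + 2 / 3 * L₂) / 1.879 + c46)) - D / η ^ 2 * N := by
    have e1 : (-NS + f0 / (2 * η) * (2 / 3 * L₂ + B * η ^ (3 / 2 : ℝ) * L₁ + logA) - f0 / (4 * η) * Iv
        + D * (1.8 + L₁ / 3 + (C₁ + 5.392 * B * (1 / Real.sqrt η - 2)) * L₁ + C₃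
          + 1 / η ^ 2 * ((logA - logη + 2 / 3 * L₂) / 1.879 + c46)) - D / η ^ 2 * N)
        - (-NS + f0 / (2 * η) * (2 / 3 * LL + B * η ^ (3 / 2 : ℝ) * Lg + logA - 1 / 2 * Iv)
          + D * (1.8 + Lg / 3 + ((C₁ + 5.392 * B * (1 / Real.sqrt η - 2)) * Lg + C₃
            + 1 / η ^ 2 * ((logA - logη + 2 / 3 * LL) / 1.879 + c46 - N))))
        = (f0 / (2 * η) * B * η ^ (3 / 2 : ℝ) + D / 3 + D * (C₁ + 5.392 * B * (1 / Real.sqrt η - 2))) * (L₁ - Lg)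
          + (f0 / (2 * η) * (2 / 3) + D * (1 / η ^ 2) * (2 / 3 / 1.879)) * (L₂ - LL) := by
      field_simp
      ring
    have hpos : 0 ≤ (f0 / (2 * η) * B * η ^ (3 / 2 : ℝ) + D / 3 + D * (C₁ + 5.392 * B * (1 / Real.sqrt η - 2))) * (L₁ - Lg)
          + (f0 / (2 * η) * (2 / 3) + D * (1 / η ^ 2) * (2 / 3 / 1.879)) * (L₂ - LL) :=
      add_nonneg (mul_nonneg hcoef1 (sub_nonneg.2 hLg)) (mul_nonneg hcoef2 (sub_nonneg.2 hLL))
    linarith only [h, e1, hpos]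
  have h4 := mul_le_mul_of_nonneg_left h3 hb
  have e2 : b * (-NS + f0 / (2 * η) * (2 / 3 * L₂ + B * η ^ (3 / 2 : ℝ) * L₁ + logA) - f0 / (4 * η) * Iv
      + D * (1.8 + L₁ / 3 + (C₁ + 5.392 * B * (1 / Real.sqrt η - 2)) * L₁ + C₃
        + 1 / η ^ 2 * ((logA - logη + 2 / 3 * L₂) / 1.879 + c46)) - D / η ^ 2 * N)
      = b * (f0 / (2 * η) * (2 / 3 * L₂ + B * η ^ (3 / 2 : ℝ) * L₁ + logA)
        + D * (1.8 + L₁ / 3 + (C₁ + 5.392 * B * (1 / Real.sqrt η - 2)) * L₁ + C₃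
          + 1 / η ^ 2 * ((logA - logη + 2 / 3 * L₂) / 1.879 + c46)))
      - b * NS - f0 / (4 * η) * (b * Iv) - D / η ^ 2 * (b * N) := by ring
  linarith only [h4, e2]

/-- The final, purely algebraic step of the proof of Lemma 4.7 (Ford §7, from (7.7) to the end):
combine the positivity (6.1), the `j = 0` bound `K(1) ≤ F(0) + 1.8D`, the summed detector
inequalities, the trigonometric-integral bound (MTY Lemma 4.4), the near-zero-sum bound with the
cancellation `c₅c²w(0) ≤ D/η²` of the `N(jt, η)` terms, the bounds (7.8)–(7.10) at the zero
`β + it`, and `1.8 + 208.5 b ≤ 209.1 b`; then divide by `b₀ f(0) = λ w(0)`.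
[cite: Ford2002Millennium, §7 (proof of Lemma 7.1, (7.7)–(7.10))] -/
theorem assembly_final
    {lam η β B c₄ w0 f0 D b₁ bS P Wd W0v Wm1v WXv K1 SK SNS SI SN V0 bd L₁ L₂ logA logη logζ sq b₀ c46
      C₁ C₃ C₃' : ℝ} (hC₃ : C₃ + 2.4 ≤ C₃')
    (hlam : 0 < lam) (hη : 0 < η) (hw0 : 0 < w0) (hf0 : f0 = lam * w0) (hc4 : 0 ≤ c₄)
    (hD : D = c₄ * lam * f0) (hb1 : 0 ≤ b₁) (hbS : 3 ≤ bS) (hb0 : b₀ = 1)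
    (hX : 0 ≤ (1 - β) / lam - 1)
    (hpos : 0 ≤ b₀ * K1 + SK) (hK1 : K1 ≤ Wm1v + 1.8 * D)
    (hSK : SK ≤ bS * (f0 / (2 * η) * (2 / 3 * L₂ + B * η ^ (3 / 2 : ℝ) * L₁ + logA)
        + D * (1.8 + L₁ / 3 + (C₁ + 5.392 * B * (1 / sq - 2)) * L₁ + C₃
          + 1 / η ^ 2 * ((logA - logη + 2 / 3 * L₂) / 1.879 + c46)))
        - SNS - f0 / (4 * η) * SI - D / η ^ 2 * SN)
    (hSI : -2 * b₀ * logζ ≤ SI) (hSNS : -SNS ≤ -(b₁ * V0) + bd * SN) (hbd : bd ≤ D / η ^ 2)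
    (hSN : 0 ≤ SN) (hV0 : -(0.087 * π ^ 2 * f0 * (1 - β) / η ^ 2) + WXv ≤ V0)
    (hWX : W0v - WXv ≤ ((1 - β) / lam - 1) * (-Wd)) (hid : b₁ * W0v - Wm1v = w0 * P) :
    1 / lam * (P - |Wd| * b₁ / (w0 * b₀) * ((1 - β) / lam - 1))
      ≤ 0.087 * π ^ 2 * (b₁ / b₀) * (1 - β) / η ^ 2
        + 1 / (2 * η) * (bS / b₀ * (2 / 3 * L₂ + B * η ^ (3 / 2 : ℝ) * L₁ + logA) + logζ)
        + c₄ * (bS / b₀) * lam * (L₁ / 3 + (C₁ + 5.392 * B * (1 / sq - 2)) * L₁ + C₃'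
            + 1 / η ^ 2 * ((logA - logη + 2 / 3 * L₂) / 1.879 + c46)) := by
  subst hb0
  set X := (1 - β) / lam - 1 with hXdef
  set Cη := C₁ + 5.392 * B * (1 / sq - 2) with hCη
  set E := (logA - logη + 2 / 3 * L₂) / 1.879 + c46 with hE
  set M := 2 / 3 * L₂ + B * η ^ (3 / 2 : ℝ) * L₁ + logA with hM
  have hf0pos : 0 < f0 := by rw [hf0]; positivity
  have hD0 : 0 ≤ D := by rw [hD]; positivity
  have h1 : -(f0 / (4 * η) * SI) ≤ f0 / (2 * η) * logζ := by
    have h := mul_le_mul_of_nonneg_left hSI (by positivity : 0 ≤ f0 / (4 * η))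
    have e : f0 / (4 * η) * (-2 * 1 * logζ) = -(f0 / (2 * η) * logζ) := by field_simp; ring
    rw [e] at h
    linarith
  have h2 : bd * SN ≤ D / η ^ 2 * SN := mul_le_mul_of_nonneg_right hbd hSN
  have h3 : b₁ * (-(0.087 * π ^ 2 * f0 * (1 - β) / η ^ 2) + WXv) ≤ b₁ * V0 :=
    mul_le_mul_of_nonneg_left hV0 hb1
  have h4 : b₁ * (W0v - WXv) ≤ b₁ * (X * |Wd|) := by
    refine mul_le_mul_of_nonneg_left (hWX.trans ?_) hb1
    exact mul_le_mul_of_nonneg_left (neg_le_abs Wd) hX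
  have hSig : w0 * P - b₁ * X * |Wd|
      ≤ 1.8 * D + bS * (f0 / (2 * η) * M + D * (1.8 + L₁ / 3 + Cη * L₁ + C₃ + 1 / η ^ 2 * E))
        + b₁ * (0.087 * π ^ 2 * f0 * (1 - β) / η ^ 2) + f0 / (2 * η) * logζ := by
    linarith [hpos, hK1, hSK, hSNS, h1, h2, h3, h4, hid]
  have hgap : 0 ≤ f0 * c₄ * lam * ((C₃' - C₃ - 1.8) * bS - 1.8) := by
    have : 0 ≤ (C₃' - C₃ - 1.8) * bS - 1.8 := by nlinarith
    positivity
  have e2 : (0.087 * π ^ 2 * (b₁ / 1) * (1 - β) / η ^ 2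
        + 1 / (2 * η) * (bS / 1 * M + logζ)
        + c₄ * (bS / 1) * lam * (L₁ / 3 + Cη * L₁ + C₃' + 1 / η ^ 2 * E)) * f0
      - (1.8 * D + bS * (f0 / (2 * η) * M + D * (1.8 + L₁ / 3 + Cη * L₁ + C₃ + 1 / η ^ 2 * E))
        + b₁ * (0.087 * π ^ 2 * f0 * (1 - β) / η ^ 2) + f0 / (2 * η) * logζ)
      = f0 * c₄ * lam * ((C₃' - C₃ - 1.8) * bS - 1.8) := by
    rw [hD]; ring
  have e1 : 1 / lam * (P - |Wd| * b₁ / (w0 * 1) * X) = (w0 * P - b₁ * X * |Wd|) / f0 := by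
    rw [hf0]; field_simp
  rw [e1, div_le_iff₀ hf0pos]
  linarith [hSig, hgap, e2]

/-! ### The assembly theorem -/

/-- **Lemma 4.7 of Mossinghoff–Trudgian–Yang with the Lemma-4.6 constant as a parameter**: the
statement of the named fact `zero_inequality_mossinghoff_trudgian_yang` with its constant `0.213`
(inherited from MTY Lemmas 4.5–4.6) replaced by `c46`; `zero_inequality_mossinghoff_trudgian_yang`
is the case `c46 = 0.213` (`zero_inequality_mossinghoff_trudgian_yang_iff_with`). Introduced so
that the assembly can be fed any proved version of MTY Lemma 4.5 (whose printed constant `0.479`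
rests on Ford's Lemma 4.2). [cite: MossinghoffTrudgianYangRNT2024, Lemma 4.7] -/
def zeroInequalityMTYWith (c46 : ℝ) : Prop :=
  ∀ A B : ℝ, 6.5 < A → 0 < B → RichertBound A B →
  ∀ θ : ℝ, IsFordTheta (mtyB40 0) (mtyB40 1) θ →
  ∀ η R : ℝ, 0 < η → η ≤ 1 / 4 → 3 ≤ R →
  ∀ β t : ℝ, 10000 ≤ t → riemannZeta (β + t * I) = 0 → 1 - β ≤ η / 2 →
  ∀ lam : ℝ, 0 < lam → lam ≤ 1 - β → lam ≤ η / (R + 1) →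
    ZetaZeroFreeRect lam t (40 * t + 1) →
    1 / lam * (Real.cos θ ^ 2
        - |fordLaplaceWDeriv0 θ| * mtyB40 1 / (fordSmoothW0 θ * mtyB40 0) * ((1 - β) / lam - 1))
      ≤ 0.087 * π ^ 2 * (mtyB40 1 / mtyB40 0) * (1 - β) / η ^ 2
        + 1 / (2 * η) * (mtyB40Sum / mtyB40 0 * (2 / 3 * Real.log (Real.log (40 * t + 1))
              + B * η ^ (3 / 2 : ℝ) * Real.log (40 * t + 1) + Real.log A)
            + Real.log (riemannZeta (1 + (η : ℂ))).re)
        + fordC5 θ R * (mtyB40Sum / mtyB40 0) * lam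
            * (Real.log (40 * t + 1) / 3
              + (5.409 + 5.392 * B * (1 / Real.sqrt η - 2)) * Real.log (40 * t + 1) + 209.1
              + 1 / η ^ 2 * ((Real.log (A / η) + 2 / 3 * Real.log (Real.log (40 * t + 1))) / 1.879
                  + c46))

/-- The named fact is the case `c46 = 0.213` of `zeroInequalityMTYWith`. [cite: MossinghoffTrudgianYangRNT2024, Lemma 4.7] -/
theorem zero_inequality_mossinghoff_trudgian_yang_iff_with :
    zero_inequality_mossinghoff_trudgian_yang ↔ zeroInequalityMTYWith 0.213 := Iff.rfl

/-- **The inequality of Lemma 4.7 with the three (3.8)/Lemma-4.5-dependent constants as parameters**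
(a predicate schema, never to be assumed as a hypothesis): `zeroInequalityMTYWith c46` with the
far-zero slope `5.409` replaced by `C₁` and the constant `209.1` by `C₃'`
(`zeroInequalityMTYWith c46 ↔ zeroInequalityMTYGen 5.409 209.1 c46`). For assemblies fed by other
explicit zero-counting bounds than (3.8). [cite: MossinghoffTrudgianYangRNT2024, Lemma 4.7] -/
def zeroInequalityMTYGen (C₁ C₃' c46 : ℝ) : Prop :=
  ∀ A B : ℝ, 6.5 < A → 0 < B → RichertBound A B →
  ∀ θ : ℝ, IsFordTheta (mtyB40 0) (mtyB40 1) θ →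
  ∀ η R : ℝ, 0 < η → η ≤ 1 / 4 → 3 ≤ R →
  ∀ β t : ℝ, 10000 ≤ t → riemannZeta (β + t * I) = 0 → 1 - β ≤ η / 2 →
  ∀ lam : ℝ, 0 < lam → lam ≤ 1 - β → lam ≤ η / (R + 1) →
    ZetaZeroFreeRect lam t (40 * t + 1) →
    1 / lam * (Real.cos θ ^ 2
        - |fordLaplaceWDeriv0 θ| * mtyB40 1 / (fordSmoothW0 θ * mtyB40 0) * ((1 - β) / lam - 1))
      ≤ 0.087 * π ^ 2 * (mtyB40 1 / mtyB40 0) * (1 - β) / η ^ 2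
        + 1 / (2 * η) * (mtyB40Sum / mtyB40 0 * (2 / 3 * Real.log (Real.log (40 * t + 1))
              + B * η ^ (3 / 2 : ℝ) * Real.log (40 * t + 1) + Real.log A)
            + Real.log (riemannZeta (1 + (η : ℂ))).re)
        + fordC5 θ R * (mtyB40Sum / mtyB40 0) * lam
            * (Real.log (40 * t + 1) / 3
              + (C₁ + 5.392 * B * (1 / Real.sqrt η - 2)) * Real.log (40 * t + 1) + C₃'
              + 1 / η ^ 2 * ((Real.log (A / η) + 2 / 3 * Real.log (Real.log (40 * t + 1))) / 1.879
                  + c46))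

/-- `zeroInequalityMTYWith c46` is the case `C₁ = 5.409`, `C₃' = 209.1` of `zeroInequalityMTYGen`.
[cite: MossinghoffTrudgianYangRNT2024, Lemma 4.7] -/
theorem zeroInequalityMTYWith_iff_gen (c46 : ℝ) :
    zeroInequalityMTYWith c46 ↔ zeroInequalityMTYGen 5.409 209.1 c46 := Iff.rfl

/-- **Lemma 4.7 of Mossinghoff–Trudgian–Yang (for `P₄₀`) with ALL (3.8)/Lemma-4.5-dependent
constants as parameters**: from the smoothed zero detector with the far-zero bound
`mtyFarZeroBoundGen C₁ C₃ c46` inserted (`C₁ ≥ 0`), MTY Lemma 4.4 and the kernel facts, the inequality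
`zeroInequalityMTYGen C₁ C₃' c46` for any `C₃' ≥ C₃ + 2.4` (`C₃ + 1.8 + 1.8b₀/b ≤ C₃ + 2.4` for
`P₄₀`). The proof is that of `zero_inequality_mossinghoff_trudgian_yang_of_detector_bound_with'`
(the printed case `C₁ = 5.409`, `C₃ = 206.7`, `C₃' = 209.1`), verbatim with the constants renamed.
[cite: MossinghoffTrudgianYangRNT2024, Lemma 4.7] [cite: Ford2002Millennium, Lemma 7.1 (proof)] -/
theorem zero_inequality_mossinghoff_trudgian_yang_of_detector_bound_gen (C₁ C₃ C₃' c46 : ℝ)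
    (hC₁ : 0 ≤ C₁) (hC₃ : C₃ + 2.4 ≤ C₃')
    (hdet : ∀ A B : ℝ, 6.5 < A → 0 < B → RichertBound A B → ∀ η : ℝ, 0 < η → η ≤ 1 / 4 →
      ∀ (f : ℝ → ℝ) (D : ℝ), IsFordSmoothing f η D →
        (∀ t : ℝ, 10000 ≤ t → FordDetectorIneq A B η f D t (mtyFarZeroBoundGen C₁ C₃ c46 A B t η)) ∧
          (fordK f 1).re ≤ (fordLaplace f 0).re + 1.8 * D)
    (h44 : ∀ (K : ℕ) (b : ℕ → ℝ), 2 ≤ K → IsNonnegTrigPoly K b → ∀ η t₁ t₂ : ℝ, 0 < η →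
      -2 * b 0 * Real.log (riemannZeta (1 + η)).re ≤
        ∑ j ∈ Finset.range K, b (j + 1) * fordLogZetaIntegral (1 + η) (((j : ℝ) + 1) * t₁) t₂)
    (hker : ∀ θ : ℝ, 0 < θ → θ < π / 2 → FordKernelFacts θ) :
    zeroInequalityMTYGen C₁ C₃' c46 := by
  intro A B hA hB hRich θ hθF η R hη hη4 hR β t ht hzero hβ lam hlam hlam1 hlam2 hrect
  have hπ := Real.pi_pos
  have hb0 : mtyB40 0 = 1 := mtyB40_zero
  rw [hb0] at hθF
  have hθ := hθF.1
  have hθ' := hθF.2.1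
  have hK := hker θ hθ hθ'
  have hb1 := mtyB40_one_ge
  have hbS := mtyB40Sum_ge
  have hbnn := isNonnegTrigPoly_mtyB40
  have htan : Real.tan θ < R := (tan_fordTheta_lt_three hb1 hθF).trans_le hR
  have hA0 : 0 < A := by linarith
  have hη2 : η ≤ 1 / 2 := by linarith
  have hR0 : 0 < R := by linarith
  have hβ1 : 0 < 1 - β := one_sub_pos_of_riemannZeta_eq_zero hzero
  have hw0 : 0 < fordSmoothW0 θ := fordSmoothW0_pos hθ hθ'
  have hf0 : fordSmoothF θ lam 0 = lam * fordSmoothW0 θ := by rw [fordSmoothF_zero, (fordKernelW_zero hθ hθ')]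
  have hf0pos : 0 < fordSmoothF θ lam 0 := by rw [hf0]; positivity
  have hc4 : 0 ≤ fordC5 θ R := by
    have := fordH_nonneg_of_pos hθ hθ' hR0
    unfold fordC5; positivity
  set D : ℝ := fordC5 θ R * lam * fordSmoothF θ lam 0 with hDdef
  have hD0 : 0 ≤ D := by positivity
  have hRl : (R + 1) * lam ≤ η := by rw [le_div_iff₀ (by linarith)] at hlam2; linarith
  -- `f` is an admissible smoothing with `F₀`-constant `D` from `η` on
  have hfS : IsFordSmoothing (fordSmoothF θ lam) η D := by
    refine ⟨contDiff_fordSmoothF hK.contDiff lam, fordSmoothF_nonneg hθ hθ' hlam,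
      ⟨2 * (θ * Real.cot θ) / lam, fun u hu ↦ fordSmoothF_eq_zero hθ hθ' hlam hu⟩, fun z hz hzη ↦ ?_⟩
    exact norm_fordLaplace_fordSmoothF_sub_le hθ hθ' hR htan hK.closed_form (fordKernelW_zero hθ hθ') hw0 hlam hz
      (hRl.trans hzη)
  -- the zero-free rectangle: zeros near `1 + i(j+1)t` have `Re ρ ≤ 1 − λ`
  have hzeros : ∀ j : ℕ, j < 40 → ∀ ρ ∈ fordNearZeros (((j : ℝ) + 1) * t) η, ρ.re ≤ 1 - lam := by
    intro j hj ρ hρ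
    rw [mem_fordNearZeros] at hρ
    by_contra hcon
    rw [not_le] at hcon
    have hre1 : ρ.re ≤ 1 := by
      by_contra h1
      exact riemannZeta_ne_zero_of_one_le_re (s := ρ) (not_le.1 h1).le hρ.1
    have hj' : (j : ℝ) + 1 ≤ 40 := by
      have : (j : ℝ) ≤ 39 := by exact_mod_cast Nat.lt_succ_iff.1 hj
      linarith
    have hj0 : (0 : ℝ) ≤ j := j.cast_nonneg
    have him : |((j : ℝ) + 1) * t - ρ.im| ≤ η := by
      have h := Complex.abs_im_le_norm (1 + ((((j : ℝ) + 1) * t : ℝ) : ℂ) * I - ρ)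
      have e : (1 + ((((j : ℝ) + 1) * t : ℝ) : ℂ) * I - ρ).im = ((j : ℝ) + 1) * t - ρ.im := by simp
      rw [e] at h
      exact h.trans hρ.2
    rw [abs_le] at him
    have ht0 : 0 ≤ t := by linarith only [ht]
    have hjt : 0 ≤ (j : ℝ) * t := mul_nonneg hj0 ht0
    have hjt2 : ((j : ℝ) + 1) * t ≤ 40 * t := mul_le_mul_of_nonneg_right hj' ht0
    refine hrect ρ hcon hre1 ?_ ?_ hρ.1
    · nlinarith only [him.2, hjt, hη4, ht]
    · linarith only [him.1, hjt2, hη4]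
  -- the detector at heights `(j+1)t`, `j < 40`, and at `j = 0`
  have hdetj : ∀ j : ℕ, j < 40 →
      FordDetectorIneq A B η (fordSmoothF θ lam) D (((j : ℝ) + 1) * t)
        (mtyFarZeroBoundGen C₁ C₃ c46 A B (((j : ℝ) + 1) * t) η) := by
    intro j hj
    have hj0 : (0 : ℝ) ≤ j := j.cast_nonneg
    have hτ : 10000 ≤ ((j : ℝ) + 1) * t := by
      have h1 : t ≤ ((j : ℝ) + 1) * t := le_mul_of_one_le_left (by linarith only [ht]) (by linarith only [hj0])
      linarith only [h1, ht]
    exact (hdet A B hA hB hRich η hη hη4 _ D hfS).1 _ hτ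
  have hK1 : (fordK (fordSmoothF θ lam) 1).re ≤ (fordLaplace (fordSmoothF θ lam) 0).re + 1.8 * D :=
    (hdet A B hA hB hRich η hη hη4 _ D hfS).2
  -- `F(0) = W(-1)`, and the kernel identity (7.9) (`ford_W_identity`, from Ford (6.5) and (4.1))
  have hF0 : (fordLaplace (fordSmoothF θ lam) 0).re = fordLaplaceW θ (-1) := by
    rw [fordLaplace_fordSmoothF hlam, zero_div, zero_sub, show (-1 : ℂ) = ((-1 : ℝ) : ℂ) by push_cast; ring,
      fordLaplaceWC_ofReal, Complex.ofReal_re]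
  have hid : mtyB40 1 * fordLaplaceW θ 0 - (fordLaplace (fordSmoothF θ lam) 0).re
      = fordSmoothW0 θ * Real.cos θ ^ 2 := by
    rw [hF0]
    have h := ford_W_identity hθF one_ne_zero
    simpa only [one_mul] using h
  -- positivity (6.1)
  have hpos := fordK_trigPoly_nonneg' (fordSmoothF_nonneg hθ hθ' hlam)
    (fun u hu ↦ fordSmoothF_eq_zero hθ hθ' hlam hu) hbnn t
  rw [hb0] at hpos
  -- logs
  have hL : ∀ j : ℕ, j < 40 → Real.log (((j : ℝ) + 1) * t) ≤ Real.log (40 * t + 1) ∧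
      Real.log (Real.log (((j : ℝ) + 1) * t)) ≤ Real.log (Real.log (40 * t + 1)) :=
    fun j hj ↦ ⟨(mty_logs_le ht hj).2.1, (mty_logs_le ht hj).2.2⟩
  -- summing the detector inequalities over `j`
  have hSK : ∑ j ∈ Finset.range 40, mtyB40 (j + 1) *
        (fordK (fordSmoothF θ lam) (1 + ((((j : ℝ) + 1) * t : ℝ) : ℂ) * I)).re
      ≤ mtyB40Sum * (fordSmoothF θ lam 0 / (2 * η) * (2 / 3 * Real.log (Real.log (40 * t + 1))
            + B * η ^ (3 / 2 : ℝ) * Real.log (40 * t + 1) + Real.log A)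
          + D * (1.8 + Real.log (40 * t + 1) / 3
            + (C₁ + 5.392 * B * (1 / Real.sqrt η - 2)) * Real.log (40 * t + 1) + C₃
            + 1 / η ^ 2 * ((Real.log A - Real.log η + 2 / 3 * Real.log (Real.log (40 * t + 1))) / 1.879 + c46)))
        - ∑ j ∈ Finset.range 40, mtyB40 (j + 1) * fordNearSum (fordSmoothF θ lam) η (((j : ℝ) + 1) * t)
        - fordSmoothF θ lam 0 / (4 * η) *
            ∑ j ∈ Finset.range 40, mtyB40 (j + 1) * fordLogZetaIntegral (1 + η) (((j : ℝ) + 1) * t) (2 * η / π)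
        - D / η ^ 2 * ∑ j ∈ Finset.range 40, mtyB40 (j + 1) * fordN (((j : ℝ) + 1) * t) η := by
    have hbSdef : ∑ j ∈ Finset.range 40, mtyB40 (j + 1) = mtyB40Sum := rfl
    rw [Finset.mul_sum, Finset.mul_sum, ← hbSdef, Finset.sum_mul, ← Finset.sum_sub_distrib,
      ← Finset.sum_sub_distrib, ← Finset.sum_sub_distrib]
    refine Finset.sum_le_sum fun j hj ↦ ?_
    rw [Finset.mem_range] at hj
    have h := hdetj j hj
    unfold FordDetectorIneq mtyFarZeroBoundGen at h
    exact detector_step hC₁ hη hη4 hf0pos.le hD0 hB.le (hbnn.1 _) (hL j hj).1 (hL j hj).2 h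
  -- MTY Lemma 4.4
  have hSI := h44 40 mtyB40 (by norm_num) hbnn η t (2 * η / π) hη
  rw [hb0] at hSI
  -- the near-zero sums
  have hκ : 0 < π / (2 * η) := by positivity
  set c : ℝ := π / (2 * η) * lam with hcdef
  set bd : ℝ := fordVBound θ R c with hbddef
  have hSNS : -(∑ j ∈ Finset.range 40, mtyB40 (j + 1) * fordNearSum (fordSmoothF θ lam) η (((j : ℝ) + 1) * t))
      ≤ -(mtyB40 1 * (fordV θ c (((π / (2 * η) * (1 - β) : ℝ)) : ℂ)).re)
        + bd * ∑ j ∈ Finset.range 40, mtyB40 (j + 1) * fordN (((j : ℝ) + 1) * t) η := by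
    have hstep : ∀ j ∈ Finset.range 40,
        -(mtyB40 (j + 1) * fordNearSum (fordSmoothF θ lam) η (((j : ℝ) + 1) * t))
          ≤ mtyB40 (j + 1) * (if j = 0 then -(fordV θ c (((π / (2 * η) * (1 - β) : ℝ)) : ℂ)).re else 0)
            + bd * (mtyB40 (j + 1) * fordN (((j : ℝ) + 1) * t) η) := by
      intro j hj
      rw [Finset.mem_range] at hj
      have hbj : 0 ≤ mtyB40 (j + 1) := hbnn.1 _
      by_cases hj0 : j = 0
      · subst hj0
        rw [if_pos rfl]
        simp only [Nat.cast_zero, zero_add, one_mul]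
        have hz0 : ∀ ρ ∈ fordNearZeros t η, ρ.re ≤ 1 - lam := by
          have h0 := hzeros 0 (by norm_num)
          simp only [Nat.cast_zero, zero_add, one_mul] at h0
          exact h0
        have h := neg_fordNearSum_le_of_zero hθ hθ' hR htan hK hlam hη hlam2 hzero
          (by linarith only [hβ, hη]) hz0
        have h' := mul_le_mul_of_nonneg_left h hbj
        linarith only [h']
      · rw [if_neg hj0, mul_zero, zero_add]
        have h := neg_fordNearSum_le hθ hθ' hR htan hK hlam hη hlam2 (hzeros j hj)
        have h' := mul_le_mul_of_nonneg_left h hbj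
        linarith only [h']
    have hsum := Finset.sum_le_sum hstep
    rw [Finset.sum_neg_distrib, Finset.sum_add_distrib, ← Finset.mul_sum] at hsum
    simp only [mul_ite, mul_zero, Finset.sum_ite_eq', Finset.mem_range, Nat.ofNat_pos, ite_true,
      zero_add] at hsum
    linarith only [hsum]
  -- the cancellation `c₅ c² w(0) ≤ D/η²` (`π² c₅/4 − c₄ = −1/R`)
  have hbd : bd ≤ D / η ^ 2 := by
    rw [hbddef, fordVBound, hDdef, hf0, hcdef, le_div_iff₀ (by positivity)]
    have h1 : 0 ≤ lam ^ 2 * fordSmoothW0 θ / R := by positivity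
    have e : fordC5 θ R * lam * (lam * fordSmoothW0 θ)
        - 4 / π ^ 2 * (fordC5 θ R - 1 / R) * (π / (2 * η) * lam) ^ 2 * fordSmoothW0 θ * η ^ 2
        = lam ^ 2 * fordSmoothW0 θ / R := by field_simp; ring
    linarith only [h1, e]
  have hSN : 0 ≤ ∑ j ∈ Finset.range 40, mtyB40 (j + 1) * fordN (((j : ℝ) + 1) * t) η :=
    Finset.sum_nonneg fun j _ ↦ mul_nonneg (hbnn.1 _) (fordN_nonneg _ _)
  -- the zero `β + it` itself: (7.8)–(7.10)
  have hX : 0 ≤ (1 - β) / lam - 1 := by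
    rw [sub_nonneg, le_div_iff₀ hlam]; linarith only [hlam1]
  have hx0 : 0 < π / (2 * η) * (1 - β) := by positivity
  have hx0' : π / (2 * η) * (1 - β) ≤ π / 4 := by
    calc π / (2 * η) * (1 - β) ≤ π / (2 * η) * (η / 2) := by gcongr
      _ = π / 4 := by field_simp; ring
  have hV0 : -(0.087 * π ^ 2 * fordSmoothF θ lam 0 * (1 - β) / η ^ 2)
      + fordLaplaceW θ ((1 - β) / lam - 1)
      ≤ (fordV θ c (((π / (2 * η) * (1 - β) : ℝ)) : ℂ)).re := by
    have hcot := cot_sub_inv_ge_real hx0 hx0'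
    have harg : (((π / (2 * η) * (1 - β) : ℝ) : ℂ)) / (c : ℂ) - 1 = (((1 - β) / lam - 1 : ℝ) : ℂ) := by
      rw [hcdef]; push_cast
      have : (lam : ℂ) ≠ 0 := by exact_mod_cast hlam.ne'
      have : (π : ℂ) ≠ 0 := by exact_mod_cast hπ.ne'
      have : (η : ℂ) ≠ 0 := by exact_mod_cast hη.ne'
      have : (2 : ℂ) ≠ 0 := by norm_num
      field_simp
    have hre : (fordV θ c (((π / (2 * η) * (1 - β) : ℝ)) : ℂ)).re
        = c * fordSmoothW0 θ * (Real.cot (π / (2 * η) * (1 - β)) - 1 / (π / (2 * η) * (1 - β)))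
          + fordLaplaceW θ ((1 - β) / lam - 1) := by
      unfold fordV
      rw [harg, fordLaplaceWC_ofReal, Complex.add_re, ← Complex.ofReal_cot, ← Complex.ofReal_one,
        ← Complex.ofReal_div, ← Complex.ofReal_sub, ← Complex.ofReal_mul, Complex.ofReal_re,
        Complex.ofReal_re]
    rw [hre, hf0, hcdef]
    have h1 := mul_le_mul_of_nonneg_left hcot (by positivity : 0 ≤ π / (2 * η) * lam * fordSmoothW0 θ)
    have e : π / (2 * η) * lam * fordSmoothW0 θ * (-0.348 * (π / (2 * η) * (1 - β)))
        = -(0.087 * π ^ 2 * (lam * fordSmoothW0 θ) * (1 - β) / η ^ 2) := by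
      field_simp; ring
    linarith only [h1, e]
  have hWX : fordLaplaceW θ 0 - fordLaplaceW θ ((1 - β) / lam - 1)
      ≤ ((1 - β) / lam - 1) * (-fordLaplaceWDeriv0 θ) := by
    have h := fordLaplaceW_zero_sub_le hθ hθ' ((1 - β) / lam - 1)
    rwa [fordKernelMoment_eq hθ hθ'] at h
  -- assemble
  rw [hb0, Real.log_div hA0.ne' hη.ne']
  exact assembly_final hC₃ hlam hη hw0 hf0 hc4 hDdef (by linarith only [hb1]) (by linarith only [hbS]) rfl hX
    hpos hK1 hSK hSI hSNS hbd hSN hV0 hWX hid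


/-- **Lemma 4.7 of Mossinghoff–Trudgian–Yang (for `P₄₀`), with the Lemma-4.6 constant `c46` as a
parameter, from the smoothed zero detector WITH its far-zero bound (`mtyFarZeroBoundWith c46`)
inserted, MTY Lemma 4.4 and the kernel facts.** This is the assembly below
(`zero_inequality_mossinghoff_trudgian_yang_of_ford`) with its two hypotheses `h42` (Ford's
Lemma 4.6 for every bound `S` of the far-zero sum) and `h46` (MTY Lemma 4.6, the bound
`S = mtyFarZeroBound A B t η`) merged into the single hypothesis `hdet` that the proof actually
consumes: for `(3.1)` with `A > 1`, `B > 0`, `0 < η ≤ 1/4`, an admissible smoothing `f` with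
`F₀`-constant `D` and `t ≥ 10⁴`, the detector inequality `FordDetectorIneq A B η f D t
(mtyFarZeroBound A B t η)`, together with `K(1) ≤ F(0) + 1.8D`. (In Ford's Lemma 4.6 the zeros
are partitioned into `|1+it−ρ| ≤ η` and its complement, so the far-zero sum that a proof of `h42`
bounds is the one over `|1+it−ρ| > η`; `hdet` is indifferent to that convention, which is why it,
rather than the pair `h42`/`h46` with closed far sums, is the interface to discharge.)
[cite: MossinghoffTrudgianYangRNT2024, Lemma 4.7] [cite: Ford2002Millennium, Lemma 7.1 (proof)]

This primed form asks `hdet` only for `A > 6.5`, the range of the fact (`zeroInequalityMTYWith`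
quantifies `6.5 < A`); a proof of the detector inequality goes through Ford's Lemma 3.4 on the line
`Re s = 1 − η`, which needs `A ≥ 6` (`zeta_bound_of_richertBound`), so this is the form to
discharge. The unprimed theorem below (any `A > 1`) is its corollary. -/
theorem zero_inequality_mossinghoff_trudgian_yang_of_detector_bound_with' (c46 : ℝ)
    (hdet : ∀ A B : ℝ, 6.5 < A → 0 < B → RichertBound A B → ∀ η : ℝ, 0 < η → η ≤ 1 / 4 →
      ∀ (f : ℝ → ℝ) (D : ℝ), IsFordSmoothing f η D →
        (∀ t : ℝ, 10000 ≤ t → FordDetectorIneq A B η f D t (mtyFarZeroBoundWith c46 A B t η)) ∧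
          (fordK f 1).re ≤ (fordLaplace f 0).re + 1.8 * D)
    (h44 : ∀ (K : ℕ) (b : ℕ → ℝ), 2 ≤ K → IsNonnegTrigPoly K b → ∀ η t₁ t₂ : ℝ, 0 < η →
      -2 * b 0 * Real.log (riemannZeta (1 + η)).re ≤
        ∑ j ∈ Finset.range K, b (j + 1) * fordLogZetaIntegral (1 + η) (((j : ℝ) + 1) * t₁) t₂)
    (hker : ∀ θ : ℝ, 0 < θ → θ < π / 2 → FordKernelFacts θ) :
    zeroInequalityMTYWith c46 :=
  (zeroInequalityMTYWith_iff_gen c46).2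
    (zero_inequality_mossinghoff_trudgian_yang_of_detector_bound_gen 5.409 206.7 209.1 c46
      (by norm_num) (by norm_num) (fun A B hA hB hR η hη hη4 f D hf ↦ hdet A B hA hB hR η hη hη4 f D hf)
      h44 hker)

/-- **Lemma 4.7 of Mossinghoff–Trudgian–Yang (for `P₄₀`), with the Lemma-4.6 constant `c46` as a
parameter, from the smoothed zero detector WITH its far-zero bound inserted** — the form with the
detector hypothesis `hdet` asked for every `A > 1` (a corollary of the primed theorem above, which
asks it only for `A > 6.5`). [cite: MossinghoffTrudgianYangRNT2024, Lemma 4.7]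
[cite: Ford2002Millennium, Lemma 7.1 (proof)] -/
theorem zero_inequality_mossinghoff_trudgian_yang_of_detector_bound_with (c46 : ℝ)
    (hdet : ∀ A B : ℝ, 1 < A → 0 < B → RichertBound A B → ∀ η : ℝ, 0 < η → η ≤ 1 / 4 →
      ∀ (f : ℝ → ℝ) (D : ℝ), IsFordSmoothing f η D →
        (∀ t : ℝ, 10000 ≤ t → FordDetectorIneq A B η f D t (mtyFarZeroBoundWith c46 A B t η)) ∧
          (fordK f 1).re ≤ (fordLaplace f 0).re + 1.8 * D)
    (h44 : ∀ (K : ℕ) (b : ℕ → ℝ), 2 ≤ K → IsNonnegTrigPoly K b → ∀ η t₁ t₂ : ℝ, 0 < η →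
      -2 * b 0 * Real.log (riemannZeta (1 + η)).re ≤
        ∑ j ∈ Finset.range K, b (j + 1) * fordLogZetaIntegral (1 + η) (((j : ℝ) + 1) * t₁) t₂)
    (hker : ∀ θ : ℝ, 0 < θ → θ < π / 2 → FordKernelFacts θ) :
    zeroInequalityMTYWith c46 :=
  zero_inequality_mossinghoff_trudgian_yang_of_detector_bound_with' c46
    (fun A B hA hB hR ↦ hdet A B (by linarith) hB hR) h44 hker

/-- **Lemma 4.7 of Mossinghoff–Trudgian–Yang (for `P₄₀`) from the smoothed zero detector WITH
its far-zero bound inserted, MTY Lemma 4.4 and the kernel facts** — the case `c46 = 0.213` of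
`zero_inequality_mossinghoff_trudgian_yang_of_detector_bound_with` (the printed constants).
[cite: MossinghoffTrudgianYangRNT2024, Lemma 4.7] [cite: Ford2002Millennium, Lemma 7.1 (proof)] -/
theorem zero_inequality_mossinghoff_trudgian_yang_of_detector_bound
    (hdet : ∀ A B : ℝ, 1 < A → 0 < B → RichertBound A B → ∀ η : ℝ, 0 < η → η ≤ 1 / 4 →
      ∀ (f : ℝ → ℝ) (D : ℝ), IsFordSmoothing f η D →
        (∀ t : ℝ, 10000 ≤ t → FordDetectorIneq A B η f D t (mtyFarZeroBound A B t η)) ∧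
          (fordK f 1).re ≤ (fordLaplace f 0).re + 1.8 * D)
    (h44 : ∀ (K : ℕ) (b : ℕ → ℝ), 2 ≤ K → IsNonnegTrigPoly K b → ∀ η t₁ t₂ : ℝ, 0 < η →
      -2 * b 0 * Real.log (riemannZeta (1 + η)).re ≤
        ∑ j ∈ Finset.range K, b (j + 1) * fordLogZetaIntegral (1 + η) (((j : ℝ) + 1) * t₁) t₂)
    (hker : ∀ θ : ℝ, 0 < θ → θ < π / 2 → FordKernelFacts θ) :
    zero_inequality_mossinghoff_trudgian_yang :=
  zero_inequality_mossinghoff_trudgian_yang_iff_with.2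
    (zero_inequality_mossinghoff_trudgian_yang_of_detector_bound_with 0.213 hdet h44 hker)

/-- **Lemma 4.7 of Mossinghoff–Trudgian–Yang (for `P₄₀`) from its printed inputs** — the tree's
named fact `zero_inequality_mossinghoff_trudgian_yang`, derived by Ford's argument (Ford 2002,
§6 (6.1)–(6.2) and §7, proof of Lemma 7.1, with MTY's substitutions) from:

* `h42` — Ford's smoothed zero detector, **Ford Lemma 4.6 = MTY Lemma 4.2 with MTY Lemma 4.3**
  ((3.1) applied on `Re s = 1 − η`): for `(3.1)` with `A > 1`, `B > 0`, `0 < η ≤ 1/2`, an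
  admissible smoothing `f` with `F₀`-constant `D`, `t ≥ 1000` and any bound `S` of the far-zero
  sum, the inequality `FordDetectorIneq A B η f D t S`, together with `K(1) ≤ F(0) + 1.8D`;
* `h44` — **MTY Lemma 4.4** (Ford Lemma 5.1 for degree `K`): for a non-negative trigonometric
  polynomial, `Σ_{j=1}^{K} b_j ∫ log|ζ(1+η+ijt₁+iut₂)|/cosh²u du ≥ −2b₀ log ζ(1+η)`;
* `h46` — **MTY Lemma 4.6** (far-zero sum, from (3.8) and MTY Lemma 4.5): for `t ≥ 10⁴`,
  `0 < η ≤ 1/4`, `Σ_{|1+it−ρ| ≥ η} |1+it−ρ|^{-2} ≤ mtyFarZeroBound A B t η`;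
* `hker` — the kernel facts of Ford §§6–7 / MTY (4.3)–(4.6) (`FordKernelFacts`).

Everything else — (6.1), the kernel's support/positivity and `F(z) = W(z/λ − 1)`, the bound (7.4)
on `W₀`, `D = C₅(R)λf(0)` (7.5)–(7.6), Ford's Lemma 4.4, the bound (7.6) on `V_c` by the maximum
principle, the use of the zero-free rectangle, the cancellation of the `N(jt, η)` terms
(`π²c₅/4 − c₄ = −1/R`), (7.8) (`cot x − 1/x ≥ −0.348x`), (7.9), (7.10) and the final division by
`b₀ f(0)` — is proved above and here; `tan θ < 3 ≤ R` for every solution of (4.1) comes from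
`fordTheta_lt`. [cite: MossinghoffTrudgianYangRNT2024, Lemma 4.7]
[cite: Ford2002Millennium, Lemma 7.1 (proof), (6.1)–(6.2), (7.5)–(7.10)] -/
theorem zero_inequality_mossinghoff_trudgian_yang_of_ford
    (h42 : ∀ A B : ℝ, 1 < A → 0 < B → RichertBound A B → ∀ η : ℝ, 0 < η → η ≤ 1 / 2 →
      ∀ (f : ℝ → ℝ) (D : ℝ), IsFordSmoothing f η D →
        (∀ t : ℝ, 1000 ≤ t → ∀ S : ℝ, FordFarZeroSumLE t η S → FordDetectorIneq A B η f D t S) ∧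
          (fordK f 1).re ≤ (fordLaplace f 0).re + 1.8 * D)
    (h44 : ∀ (K : ℕ) (b : ℕ → ℝ), 2 ≤ K → IsNonnegTrigPoly K b → ∀ η t₁ t₂ : ℝ, 0 < η →
      -2 * b 0 * Real.log (riemannZeta (1 + η)).re ≤
        ∑ j ∈ Finset.range K, b (j + 1) * fordLogZetaIntegral (1 + η) (((j : ℝ) + 1) * t₁) t₂)
    (h46 : ∀ A B : ℝ, 1 < A → 0 < B → RichertBound A B → ∀ t η : ℝ, 10000 ≤ t → 0 < η → η ≤ 1 / 4 →
      FordFarZeroSumLE t η (mtyFarZeroBound A B t η))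
    (hker : ∀ θ : ℝ, 0 < θ → θ < π / 2 → FordKernelFacts θ) :
    zero_inequality_mossinghoff_trudgian_yang :=
  zero_inequality_mossinghoff_trudgian_yang_of_detector_bound
    (fun A B hA hB hR η hη hη4 f D hf ↦
      ⟨fun t ht ↦ (h42 A B hA hB hR η hη (by linarith) f D hf).1 t (by linarith) _
          (h46 A B hA hB hR t η ht hη hη4),
        (h42 A B hA hB hR η hη (by linarith) f D hf).2⟩)
    h44 hker

end Literature.NumberTheory.LFunctions
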